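import Literature.Analysis.FluidPDE.TaoForcedFiniteEnergyLerayHopfAE
import Literature.Analysis.FluidPDE.TaoForcedNormalisedPressureDischarge
import Literature.Analysis.FluidPDE.NormalisedPressureAffine
import Literature.Analysis.SingularIntegrals.HardyLittlewoodSobolev
import HarnessLib

/-!
# Tao 2011, Lemma 8.1 (arXiv Lemma 44) WITH force — the global energy inequality is a THEOREM:
# discharge of `tao2011_forced_finiteEnergy_energyBound`

Analysis/FluidPDE proof file (no definitions, no named facts, no `sorry`). It proves the named fact
`tao2011_forced_finiteEnergy_energyBound` of `TaoForcedNormalisedPressure.lean` (Tao 2011 =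
arXiv:1108.1165, **Lemma 8.1** = arXiv Lemma 44, *global energy inequality*, p. 24: a finite energy
almost smooth solution `(u,p,u₀,f,T)` obeys
`‖u‖_{L^∞_tL²_x} + ‖∇u‖_{L²_tL²_x} ≲ E(u₀,f,T)^{1/2}`, `E(u₀,f,T) = ½(‖u₀‖_{L²} + ‖f‖_{L¹_tL²_x})²`,
absolute constant), in the tree's rendering: classical solutions jointly smooth on the closed slab
`[0,T] × ℝ³`, smooth force of finite `L¹_t L²_x` norm, `sup_t ∫|u(t)|² < ∞`; conclusion with the
absolute constant `C = 4`:

* `tao2011_forced_finiteEnergy_energyBound_holds : tao2011_forced_finiteEnergy_energyBound`.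

## The printed proof and the line taken here (Tao 2011, §8, (53)–(65), pp. 24–26)

Tao first uses the forcing symmetry (31) to make `f` divergence free, so that `∇p = ∇p̃`,
`p̃ = -Δ⁻¹∂ᵢ∂ⱼ(uᵢuⱼ)` (54); then the localised energy `E_{η⁴}` obeys (61)
`∂ₜE = -X₁ + X₂ + X₃ + X₄ + X₅` with the forcing term `X₄ = ∫ u·f η⁴ ≲ E_{η⁴}^{1/2} a(t)`,
`a(t) = ‖f(t)‖_{L²}`, `∫₀ᵀ a ≲ E(u₀,f,T)^{1/2}`, the other terms as in the unforced case
((62)–(65)); integrating and letting the cut-off radius `R → ∞` gives the claim with an absolute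
constant (the a priori bound `A = ‖u‖_{L^∞L²}` only enters the error terms `A²/r² + A⁶/r⁴`, which
vanish in the limit).

In the tree's FIXED rendering the pressure `p` is the given one, so the forcing symmetry is replaced
(exactly as in the cell's `TaoForcedFiniteEnergyLerayHopfAE`, seat ecbridge-2) by Tao's Lemma 4.1 (i)
WITH force in its corrected a.e. form — now a THEOREM of the tree,
`tao2011_forced_pressure_normalisation_ae_holds` (`TaoForcedNormalisedPressureDischarge`):
`∇p = ∇p̃ + ∇Φ` for a.e. `t`, `Φ = Δ⁻¹∇·f(t)` (`forcePotential`). The `p̃`-part of the pressure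
term is the tree's theorem `tao2011_pressureTerm_estimate_holds` (X₅); the transport and viscous
terms are the tree's slice lemmas `half_transport_le`, `neg_viscous_cross_le`
(`TaoEnergyLocalisationProofs`); the identity (61) integrated in time is the tree's
`IsClassicalNSSolutionOn.energy_balance_cutoff`. Two terms are NEW relative to the cell's AE file,
which assumed UNIFORM slice bounds `∫|f(t)|² ≤ C_f` and `∫|Δ⁻¹∇·f(t)|² ≤ Π` (hypotheses the named
fact does not have: its force is only smooth on the slab with `∫₀ᵀ‖f(t)‖_{L²} dt < ∞`, so slices may
be unbounded, even infinite on a null set of times, and `Δ⁻¹∇·f(t)` need not be square integrable):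

* the **work of the force** `X₄` is bounded per slice by `(2E_{θ⁸}(t))^{1/2}‖f(t)‖_{L²}` (Cauchy–
  Schwarz with the weight inside) and in time by `(2M)^{1/2} Λ`, `M = sup_{[0,t]} E_{θ⁸}`,
  `Λ = ∫₀ᵀ‖f‖_{L²}`; the supremum is then absorbed (`M ≤ B + (2M)^{1/2}Λ ⟹ M ≤ 2B + 2Λ²`) — this
  is Tao's "`∂ₜ(E_{η⁴} + E)^{1/2} ≲ … + a(t)`" step in integrated form;
* the **force-potential part of the pressure term** `X_Φ = ∫ Φ u·∇(θ⁸) = 8∫ Φ θ⁷ u·∇θ`: since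
  `|Φ| = |Δ⁻¹∇·f(t)| ≤ (1/ω₃) I₁|f(t)|` pointwise (`I₁` the Riesz potential of order one,
  `|∇Γ(z)| = 1/(ω₃|z|²)`), the **Hardy–Littlewood–Sobolev inequality** of the tree
  (`SingularIntegrals/HardyLittlewoodSobolev`, Stein 1970 Ch. V Thm. 1: `‖I₁g‖_{L⁶} ≲ ‖g‖_{L²}` on
  `ℝ³`) and Hölder (`L⁶ × L² × L³` on the shell `{R(R-r) ≤ |x|² ≤ R²}` carrying `∇θ`, `r = R/4`,
  `|shell|^{1/3} ≲ R`) give `|X_Φ(t)| ≲ A ‖I₁|f(t)|‖_{L⁶(|x|² ≥ R(R-r))}`; integrated in time this is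
  `A Ψ_R` with `Ψ_R → 0` as `R → ∞` (dominated convergence in `t`, dominated by
  `C‖f(t)‖_{L²} ∈ L¹(0,T)`; the tails of an `L⁶` function vanish) — the one place where the a priori
  bound `A` meets the force, again only in a vanishing error term.

With `R = n + 1`, `r = R/4` this yields, for every `n` and `t ∈ [0,T]`,
`E_{θ_n⁸}(u(t)) + (ν/2)∫₀ᵗ∫θ_n⁸|∇u|² ≤ 2(½∫|u₀|² + ε_n) + 2Λ²` with `ε_n → 0`
(`localisedEnergy_le_forced_integrable`), and the limit `n → ∞` (dominated convergence for the
energy slices, monotone convergence for the dissipation, as in the tree's unforced assembly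
`tao_finite_energy_smooth_energy_bound_of_localisedEnergyInequality`) gives
`sup_t ∫|u(t)|² ≤ 2∫|u₀|² + 4Λ²` and `ν∫₀ᵀ∫|∇u|² ≤ 2∫|u₀|² + 4Λ²`, both `≤ 4(‖u₀‖_{L²} + Λ)²`.

Cell `pub/ns-blowup` (seat ns-blowup-lit g9): Literature debt discharge (the fact was vendored by
lit g6, p410096). WHAT THIS IS NOT: not a statement about blow-up — an a priori energy bound for
smooth finite-energy solutions of the forced system.

## References

* T. Tao, *Localisation and compactness properties of the Navier–Stokes global regularity
  problem*, Anal. PDE 6 (2013) 25–107 = arXiv:1108.1165 (`Tao2011`): Lemma 8.1 (arXiv Lemma 44)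
  and its proof, §8 (53)–(65), pp. 24–26 (held text `paper:arxiv-1108.1165`, p0024–p0025);
  Lemma 4.1 (i) (arXiv Lemma 25 (i)), p. 14; (6)–(9) pp. 3–5.
* E. M. Stein, *Singular integrals and differentiability properties of functions*, Princeton
  (1970), Ch. V §1.2 Theorem 1 (Hardy–Littlewood–Sobolev). [Stein1971]
* D. Gilbarg, N. Trudinger, *Elliptic PDE of second order*, (2.12)–(2.13) (the Newtonian kernel and
  its gradient; normalisation as in the tree's `forceKernel`). [GilbargTrudinger2001]
-/

noncomputable section

open MeasureTheory Set Filter Topology Metric Function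
open scoped ENNReal NNReal RealInnerProductSpace

namespace Literature.Analysis.FluidPDE

open SingularIntegrals

/-! ## 1. The force potential is dominated by the Riesz potential of order one; HLS on `ℝ³` -/

section Potential

/-- `finrank ℝ ℝ³ = 3` as a real number. [folklore] -/
private theorem finrank_fin3_real :
    (Module.finrank ℝ (EuclideanSpace ℝ (Fin 3)) : ℝ) = 3 := by
  rw [finrank_euclideanSpace_fin]; norm_num

/-- **Pointwise kernel bound**: `|∇Γ(z)·v| = |⟪z,v⟫|/(ω₃|z|³) ≤ ω₃⁻¹ |v| |z|^{1-3}` (with the junk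
conventions `forceKernel 0 v = 0`, `0^{-2} = 0` both sides vanish on the diagonal).
[cite: Tao2011, (9) p. 5] -/
theorem enorm_forceKernel_le (z v : EuclideanSpace ℝ (Fin 3)) :
    ‖forceKernel z v‖ₑ ≤ ENNReal.ofReal (unitSphereArea (EuclideanSpace ℝ (Fin 3)))⁻¹ *
      (‖v‖ₑ * ENNReal.ofReal (‖z‖ ^ ((1 : ℝ) - (Module.finrank ℝ (EuclideanSpace ℝ (Fin 3)) : ℝ)))) := by
  have hω : 0 < unitSphereArea (EuclideanSpace ℝ (Fin 3)) := unitSphereArea_pos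
  by_cases hz : z = 0
  · subst hz; simp
  have hzn : 0 < ‖z‖ := norm_pos_iff.2 hz
  have hω0 : unitSphereArea (EuclideanSpace ℝ (Fin 3)) ≠ 0 := hω.ne'
  have hz0 : ‖z‖ ≠ 0 := hzn.ne'
  have hden : 0 < unitSphereArea (EuclideanSpace ℝ (Fin 3)) *
      ‖z‖ ^ Module.finrank ℝ (EuclideanSpace ℝ (Fin 3)) := mul_pos hω (pow_pos hzn _)
  have hreal : |forceKernel z v| ≤ (unitSphereArea (EuclideanSpace ℝ (Fin 3)))⁻¹ *
      (‖v‖ * ‖z‖ ^ ((1 : ℝ) - (Module.finrank ℝ (EuclideanSpace ℝ (Fin 3)) : ℝ))) := by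
    rw [forceKernel, abs_div, abs_of_pos hden, div_le_iff₀ hden, Real.rpow_sub hzn, Real.rpow_one,
      Real.rpow_natCast]
    calc |⟪z, v⟫| ≤ ‖z‖ * ‖v‖ := abs_real_inner_le_norm z v
      _ = (unitSphereArea (EuclideanSpace ℝ (Fin 3)))⁻¹ *
            (‖v‖ * (‖z‖ / ‖z‖ ^ Module.finrank ℝ (EuclideanSpace ℝ (Fin 3)))) *
            (unitSphereArea (EuclideanSpace ℝ (Fin 3)) *
              ‖z‖ ^ Module.finrank ℝ (EuclideanSpace ℝ (Fin 3))) := by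
          field_simp
  rw [Real.enorm_eq_ofReal_abs, ← ofReal_norm, ← ENNReal.ofReal_mul (norm_nonneg _),
    ← ENNReal.ofReal_mul (inv_nonneg.2 hω.le)]
  exact ENNReal.ofReal_le_ofReal hreal

/-- **The force potential is dominated by the Riesz potential of order one**:
`|Δ⁻¹∇·g (x)| ≤ ω₃⁻¹ ∫ |g(y)| |x-y|^{-2} dy = ω₃⁻¹ I₁|g|(x)` for every slice `g` and every `x`
(the Bochner integral is dominated by the lower integral of the norm; junk-safe).
[cite: Tao2011, (9) p. 5] -/
theorem enorm_forcePotential_le_rieszPotential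
    (g : EuclideanSpace ℝ (Fin 3) → EuclideanSpace ℝ (Fin 3)) (x : EuclideanSpace ℝ (Fin 3)) :
    ‖forcePotential g x‖ₑ ≤ ENNReal.ofReal (unitSphereArea (EuclideanSpace ℝ (Fin 3)))⁻¹ *
      rieszPotential volume 1 (fun y => ‖g y‖ₑ) x := by
  rw [forcePotential, rieszPotential_def]
  refine (enorm_integral_le_lintegral_enorm _).trans ?_
  rw [← lintegral_const_mul' _ _ ENNReal.ofReal_ne_top]
  exact lintegral_mono fun y => enorm_forceKernel_le (x - y) (g y)

/-- **Hardy–Littlewood–Sobolev on `ℝ³`, `α = 1`, `p = 2`, `q = 6`**: there is a finite constant `C`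
with `‖I₁Φ‖_{L⁶} ≤ C ‖Φ‖_{L²}` for every a.e.-measurable size `Φ` (Stein 1970, Ch. V §1.2 Thm. 1
(b), the tree's `lintegral_rieszPotential_rpow_le'`). [cite: Stein1971, Ch. V §1.2 Theorem 1 (b)] -/
theorem exists_hls_one_two_six :
    ∃ C : ℝ≥0∞, C < ⊤ ∧ ∀ Φ : EuclideanSpace ℝ (Fin 3) → ℝ≥0∞, AEMeasurable Φ volume →
      (∫⁻ x, rieszPotential volume 1 Φ x ^ (6 : ℝ)) ^ (1 / 6 : ℝ) ≤
        C * (∫⁻ y, Φ y ^ (2 : ℝ)) ^ (1 / 2 : ℝ) := by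
  have h3 := finrank_fin3_real
  obtain ⟨C, hC, H⟩ := lintegral_rieszPotential_rpow_le' (E := EuclideanSpace ℝ (Fin 3))
    (μ := volume) (α := 1) (p := 2) (by norm_num) (by norm_num) (by rw [h3]; norm_num)
  refine ⟨C, hC, fun Φ hΦ => ?_⟩
  have e6 : (Module.finrank ℝ (EuclideanSpace ℝ (Fin 3)) : ℝ) * 2 /
      ((Module.finrank ℝ (EuclideanSpace ℝ (Fin 3)) : ℝ) - 1 * 2) = 6 := by
    rw [h3]; norm_num
  have := H Φ hΦ
  rw [e6] at this
  exact this

end Potential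

/-! ## 2. The force-potential part of the pressure term on a slice: Hölder on the shell + HLS -/

section PotentialSlice

variable {R r : ℝ}

/-- Inside the ball `|x|² < R(R-r)` the cut-off `θ_{R,r}` is locally equal to `1`, so every power
`θ^m` has zero derivative there. [cite: Tao2011, §8, proof of Lemma 8.1, (58)] -/
theorem fderiv_taoCutoff_pow_eq_zero_of_sq_lt (hR : 0 < R) (hr : 0 < r)
    {x : EuclideanSpace ℝ (Fin 3)} (hx : ‖x‖ ^ 2 < R * (R - r)) (m : ℕ) :
    fderiv ℝ (fun y : EuclideanSpace ℝ (Fin 3) => taoCutoff R r y ^ m) x = 0 := by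
  have hU : IsOpen {y : EuclideanSpace ℝ (Fin 3) | ‖y‖ ^ 2 < R * (R - r)} :=
    isOpen_lt (by fun_prop) continuous_const
  have hev : (fun y : EuclideanSpace ℝ (Fin 3) => taoCutoff R r y ^ m) =ᶠ[𝓝 x]
      fun _ => (1 : ℝ) := by
    filter_upwards [hU.mem_nhds hx] with y hy
    rw [taoCutoff_eq_one hR hr (le_of_lt hy), one_pow]
  rw [hev.fderiv_eq]
  exact fderiv_const_apply _

/-- Outside the closed ball `B̄(0,R)` the cut-off vanishes identically, so every power `θ^m`,
`m ≠ 0`, has zero derivative there. [cite: Tao2011, §8, proof of Lemma 8.1, (58)] -/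
theorem fderiv_taoCutoff_pow_eq_zero_of_lt_norm (hR : 0 ≤ R) (hr : 0 ≤ r)
    {x : EuclideanSpace ℝ (Fin 3)} (hx : R < ‖x‖) {m : ℕ} (hm : m ≠ 0) :
    fderiv ℝ (fun y : EuclideanSpace ℝ (Fin 3) => taoCutoff R r y ^ m) x = 0 := by
  have hU : IsOpen {y : EuclideanSpace ℝ (Fin 3) | R < ‖y‖} :=
    isOpen_lt continuous_const continuous_norm
  have hev : (fun y : EuclideanSpace ℝ (Fin 3) => taoCutoff R r y ^ m) =ᶠ[𝓝 x]
      fun _ => (0 : ℝ) := by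
    filter_upwards [hU.mem_nhds hx] with y hy
    rw [taoCutoff_eq_zero hR hr (le_of_lt hy), zero_pow hm]
  rw [hev.fderiv_eq]
  exact fderiv_const_apply _

/-- **The weight `D(θ⁸)(x)(v(x))` lives on the shell** `{R(R-r) ≤ |x|² } ∩ B̄(0,R)` and is bounded
by `8(C₁/r)|v(x)|` there (`|D(θ⁸)| ≤ 8θ⁷|Dθ|`, (58)). [cite: Tao2011, §8, proof of Lemma 8.1, (58)] -/
theorem enorm_fderiv_taoCutoff_pow_eight_apply_le_indicator (hR : 0 < R) (hr : 0 < r) {C₁ : ℝ}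
    (hC : ∀ x : EuclideanSpace ℝ (Fin 3), ‖fderiv ℝ (taoCutoff R r) x‖ ≤ C₁ / r) (hC0 : 0 ≤ C₁)
    (v : EuclideanSpace ℝ (Fin 3) → EuclideanSpace ℝ (Fin 3)) (x : EuclideanSpace ℝ (Fin 3)) :
    ‖fderiv ℝ (fun y : EuclideanSpace ℝ (Fin 3) => taoCutoff R r y ^ 8) x (v x)‖ₑ ≤
      ENNReal.ofReal (8 * (C₁ / r)) *
        ({y : EuclideanSpace ℝ (Fin 3) | R * (R - r) ≤ ‖y‖ ^ 2} ∩ closedBall 0 R).indicator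
          (fun y => ‖v y‖ₑ) x := by
  by_cases hx : x ∈ {y : EuclideanSpace ℝ (Fin 3) | R * (R - r) ≤ ‖y‖ ^ 2} ∩ closedBall 0 R
  · rw [indicator_of_mem hx, Real.enorm_eq_ofReal_abs, ← ofReal_norm,
      ← ENNReal.ofReal_mul (by positivity)]
    refine ENNReal.ofReal_le_ofReal ((abs_fderiv_taoCutoff_pow_eight_apply_le hC x (v x)).trans ?_)
    have h7 : taoCutoff R r x ^ 7 ≤ 1 := taoCutoff_pow_le_one R r x 7
    have h70 : 0 ≤ taoCutoff R r x ^ 7 := taoCutoff_pow_nonneg R r x 7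
    have hc : 0 ≤ C₁ / r := by positivity
    nlinarith [norm_nonneg (v x), mul_nonneg hc (norm_nonneg (v x))]
  · rw [indicator_of_notMem hx, mul_zero]
    rw [mem_inter_iff, not_and_or, mem_setOf_eq, not_le, mem_closedBall_zero_iff, not_le] at hx
    rcases hx with hx | hx
    · rw [fderiv_taoCutoff_pow_eq_zero_of_sq_lt hR hr hx 8]; simp
    · rw [fderiv_taoCutoff_pow_eq_zero_of_lt_norm hR.le hr.le hx (by norm_num : (8 : ℕ) ≠ 0)]; simp

/-- **Hölder on a set of finite measure**: `∫_S J|v| ≤ ‖J‖_{L⁶(S)} ‖v‖_{L²(S)} |S|^{1/3}`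
(`L⁶ × L^{6/5}`, then `L^{6/5} ⊂ L²` on `S` with `|S|^{5/6 - 1/2}`). [folklore] -/
private theorem lintegral_mul_enorm_le_L6_L2 {S : Set (EuclideanSpace ℝ (Fin 3))}
    {J : EuclideanSpace ℝ (Fin 3) → ℝ≥0∞} (hJ : AEMeasurable J (volume.restrict S))
    {v : EuclideanSpace ℝ (Fin 3) → EuclideanSpace ℝ (Fin 3)}
    (hv : AEMeasurable (fun x => ‖v x‖ₑ) (volume.restrict S)) :
    ∫⁻ x in S, J x * ‖v x‖ₑ ≤
      (∫⁻ x in S, J x ^ (6 : ℝ)) ^ (1 / 6 : ℝ) *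
        ((∫⁻ x in S, ‖v x‖ₑ ^ (2 : ℝ)) ^ (1 / 2 : ℝ) * volume S ^ (1 / 3 : ℝ)) := by
  set μ : Measure (EuclideanSpace ℝ (Fin 3)) := volume.restrict S with hμ
  have hpq : Real.HolderConjugate 6 (6 / 5) := Real.holderConjugate_iff.2 ⟨by norm_num, by norm_num⟩
  have h1 := ENNReal.lintegral_mul_le_Lp_mul_Lq μ hpq hJ hv
  have hpq' : Real.HolderConjugate (5 / 3) (5 / 2) :=
    Real.holderConjugate_iff.2 ⟨by norm_num, by norm_num⟩
  have h2 := ENNReal.lintegral_mul_le_Lp_mul_Lq μ hpq' (f := fun x => ‖v x‖ₑ ^ (6 / 5 : ℝ))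
    (g := fun _ => 1) (hv.pow_const _) aemeasurable_const
  have e1 : ∀ x : EuclideanSpace ℝ (Fin 3), (‖v x‖ₑ ^ (6 / 5 : ℝ)) ^ (5 / 3 : ℝ) = ‖v x‖ₑ ^ (2 : ℝ) := by
    intro x
    rw [← ENNReal.rpow_mul]
    norm_num
  have hμS : ∫⁻ _x, (1 : ℝ≥0∞) ^ (5 / 2 : ℝ) ∂μ = volume S := by
    rw [ENNReal.one_rpow, lintegral_const, one_mul, hμ, Measure.restrict_apply_univ]
  have h2' : ∫⁻ x, ‖v x‖ₑ ^ (6 / 5 : ℝ) ∂μ ≤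
      (∫⁻ x, ‖v x‖ₑ ^ (2 : ℝ) ∂μ) ^ (3 / 5 : ℝ) * volume S ^ (2 / 5 : ℝ) := by
    have h := h2
    simp only [Pi.mul_apply, mul_one, e1, hμS] at h
    have e2 : (1 / (5 / 3) : ℝ) = 3 / 5 := by norm_num
    have e3 : (1 / (5 / 2) : ℝ) = 2 / 5 := by norm_num
    rw [e2, e3] at h
    exact h
  have h3 : (∫⁻ x, ‖v x‖ₑ ^ (6 / 5 : ℝ) ∂μ) ^ (1 / (6 / 5) : ℝ) ≤
      (∫⁻ x, ‖v x‖ₑ ^ (2 : ℝ) ∂μ) ^ (1 / 2 : ℝ) * volume S ^ (1 / 3 : ℝ) := by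
    have h56 : (1 / (6 / 5) : ℝ) = 5 / 6 := by norm_num
    rw [h56]
    calc (∫⁻ x, ‖v x‖ₑ ^ (6 / 5 : ℝ) ∂μ) ^ (5 / 6 : ℝ)
        ≤ ((∫⁻ x, ‖v x‖ₑ ^ (2 : ℝ) ∂μ) ^ (3 / 5 : ℝ) * volume S ^ (2 / 5 : ℝ)) ^ (5 / 6 : ℝ) :=
          ENNReal.rpow_le_rpow h2' (by norm_num)
      _ = (∫⁻ x, ‖v x‖ₑ ^ (2 : ℝ) ∂μ) ^ (1 / 2 : ℝ) * volume S ^ (1 / 3 : ℝ) := by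
          rw [ENNReal.mul_rpow_of_nonneg _ _ (by norm_num), ← ENNReal.rpow_mul, ← ENNReal.rpow_mul]
          norm_num
  calc ∫⁻ x in S, J x * ‖v x‖ₑ = ∫⁻ x, (J * fun x => ‖v x‖ₑ) x ∂μ := rfl
    _ ≤ (∫⁻ x, J x ^ (6 : ℝ) ∂μ) ^ (1 / 6 : ℝ) *
          (∫⁻ x, ‖v x‖ₑ ^ (6 / 5 : ℝ) ∂μ) ^ (1 / (6 / 5) : ℝ) := h1
    _ ≤ (∫⁻ x, J x ^ (6 : ℝ) ∂μ) ^ (1 / 6 : ℝ) *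
          ((∫⁻ x, ‖v x‖ₑ ^ (2 : ℝ) ∂μ) ^ (1 / 2 : ℝ) * volume S ^ (1 / 3 : ℝ)) :=
        mul_le_mul' le_rfl h3

/-- `|B̄(0,R)|^{1/3} = R |B̄(0,1)|^{1/3}` in `ℝ³` (`R ≥ 0`). [folklore] -/
private theorem volume_closedBall_rpow_third {R : ℝ} (hR : 0 ≤ R) :
    volume (closedBall (0 : EuclideanSpace ℝ (Fin 3)) R) ^ (1 / 3 : ℝ) =
      ENNReal.ofReal R * volume (closedBall (0 : EuclideanSpace ℝ (Fin 3)) 1) ^ (1 / 3 : ℝ) := by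
  rw [Measure.addHaar_closedBall' volume (0 : EuclideanSpace ℝ (Fin 3)) hR,
    finrank_euclideanSpace_fin, ENNReal.mul_rpow_of_nonneg _ _ (by norm_num),
    ENNReal.ofReal_rpow_of_nonneg (by positivity) (by norm_num)]
  congr 2
  rw [show ((1 : ℝ) / 3) = ((3 : ℕ) : ℝ)⁻¹ by norm_num]
  exact Real.pow_rpow_inv_natCast hR (by norm_num)

/-- **The force-potential part of the pressure term, per slice** (the NEW term relative to (64):
`X_Φ = ∫ Φ D(θ⁸)(v)`, `Φ = Δ⁻¹∇·g`): by `|Φ| ≤ ω₃⁻¹ I₁|g|`, the shell support of `D(θ⁸)`,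
Hölder `L⁶ × L² × L³` on the shell and `|B̄(0,R)|^{1/3} = R|B̄₁|^{1/3}`,
`|X_Φ| ≤ 8(C₁/r) ω₃⁻¹ R A |B̄₁|^{1/3} ‖I₁|g|‖_{L⁶(|x|² ≥ R(R-r))}` when `∫|v|² ≤ A²`
(extended-real form; both sides may be `∞` off the finite energy class).
[cite: Tao2011, §8, proof of Lemma 8.1, (54) with (9) and (64)] -/
theorem enorm_integral_forcePotential_mul_fderiv_cutoff_le
    {g v : EuclideanSpace ℝ (Fin 3) → EuclideanSpace ℝ (Fin 3)} (hg : Continuous g)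
    (hv : Continuous v) {A : ℝ} (hA0 : 0 ≤ A)
    (hA : ∫⁻ x, ‖v x‖ₑ ^ 2 ≤ ENNReal.ofReal (A ^ 2)) (hR : 0 < R) (hr : 0 < r) {C₁ : ℝ}
    (hC : ∀ x : EuclideanSpace ℝ (Fin 3), ‖fderiv ℝ (taoCutoff R r) x‖ ≤ C₁ / r) (hC0 : 0 ≤ C₁) :
    ‖∫ x, forcePotential g x *
        fderiv ℝ (fun y : EuclideanSpace ℝ (Fin 3) => taoCutoff R r y ^ 8) x (v x)‖ₑ ≤
      ENNReal.ofReal (8 * (C₁ / r) * (unitSphereArea (EuclideanSpace ℝ (Fin 3)))⁻¹ * R * A) *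
        volume (closedBall (0 : EuclideanSpace ℝ (Fin 3)) 1) ^ (1 / 3 : ℝ) *
        (∫⁻ x in {y : EuclideanSpace ℝ (Fin 3) | R * (R - r) ≤ ‖y‖ ^ 2},
          rieszPotential volume 1 (fun y => ‖g y‖ₑ) x ^ (6 : ℝ)) ^ (1 / 6 : ℝ) := by
  set S : Set (EuclideanSpace ℝ (Fin 3)) :=
    {y : EuclideanSpace ℝ (Fin 3) | R * (R - r) ≤ ‖y‖ ^ 2} ∩ closedBall 0 R with hS
  set J : EuclideanSpace ℝ (Fin 3) → ℝ≥0∞ := rieszPotential volume 1 (fun y => ‖g y‖ₑ) with hJ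
  have hSm : MeasurableSet S :=
    (measurableSet_le measurable_const (continuous_norm.pow 2).measurable).inter
      measurableSet_closedBall
  have hJm : Measurable J := measurable_rieszPotential volume 1 hg.measurable.enorm
  have hω : 0 < unitSphereArea (EuclideanSpace ℝ (Fin 3)) := unitSphereArea_pos
  set cω : ℝ := (unitSphereArea (EuclideanSpace ℝ (Fin 3)))⁻¹ with hcω
  have hcω0 : 0 ≤ cω := inv_nonneg.2 hω.le
  -- pointwise domination of the integrand
  have hpt : ∀ x, ‖forcePotential g x *
      fderiv ℝ (fun y : EuclideanSpace ℝ (Fin 3) => taoCutoff R r y ^ 8) x (v x)‖ₑ ≤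
      ENNReal.ofReal cω * ENNReal.ofReal (8 * (C₁ / r)) *
        S.indicator (fun y => J y * ‖v y‖ₑ) x := by
    intro x
    rw [enorm_mul]
    calc ‖forcePotential g x‖ₑ *
          ‖fderiv ℝ (fun y : EuclideanSpace ℝ (Fin 3) => taoCutoff R r y ^ 8) x (v x)‖ₑ
        ≤ (ENNReal.ofReal cω * J x) * (ENNReal.ofReal (8 * (C₁ / r)) *
            S.indicator (fun y => ‖v y‖ₑ) x) :=
          mul_le_mul' (enorm_forcePotential_le_rieszPotential g x)
            (enorm_fderiv_taoCutoff_pow_eight_apply_le_indicator hR hr hC hC0 v x)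
      _ = ENNReal.ofReal cω * ENNReal.ofReal (8 * (C₁ / r)) *
            S.indicator (fun y => J y * ‖v y‖ₑ) x := by
          by_cases hx : x ∈ S
          · simp only [indicator_of_mem hx]; ring
          · simp only [indicator_of_notMem hx, mul_zero]
  -- integrate
  have hint : ‖∫ x, forcePotential g x *
      fderiv ℝ (fun y : EuclideanSpace ℝ (Fin 3) => taoCutoff R r y ^ 8) x (v x)‖ₑ ≤
      ENNReal.ofReal cω * ENNReal.ofReal (8 * (C₁ / r)) * ∫⁻ x in S, J x * ‖v x‖ₑ := by
    refine (enorm_integral_le_lintegral_enorm _).trans ?_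
    calc ∫⁻ x, ‖forcePotential g x *
          fderiv ℝ (fun y : EuclideanSpace ℝ (Fin 3) => taoCutoff R r y ^ 8) x (v x)‖ₑ
        ≤ ∫⁻ x, ENNReal.ofReal cω * ENNReal.ofReal (8 * (C₁ / r)) *
            S.indicator (fun y => J y * ‖v y‖ₑ) x := lintegral_mono hpt
      _ = ENNReal.ofReal cω * ENNReal.ofReal (8 * (C₁ / r)) * ∫⁻ x in S, J x * ‖v x‖ₑ := by
          rw [lintegral_const_mul' _ _ (ENNReal.mul_ne_top ENNReal.ofReal_ne_top ENNReal.ofReal_ne_top),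
            lintegral_indicator hSm]
  -- Hölder on the shell
  have hH := lintegral_mul_enorm_le_L6_L2 (S := S) hJm.aemeasurable hv.enorm.aemeasurable
  -- the three factors
  have hF1 : (∫⁻ x in S, J x ^ (6 : ℝ)) ^ (1 / 6 : ℝ) ≤
      (∫⁻ x in {y : EuclideanSpace ℝ (Fin 3) | R * (R - r) ≤ ‖y‖ ^ 2}, J x ^ (6 : ℝ)) ^ (1 / 6 : ℝ) :=
    ENNReal.rpow_le_rpow (lintegral_mono_set inter_subset_left) (by norm_num)
  have hF2 : (∫⁻ x in S, ‖v x‖ₑ ^ (2 : ℝ)) ^ (1 / 2 : ℝ) ≤ ENNReal.ofReal A := by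
    have h2 : ∫⁻ x in S, ‖v x‖ₑ ^ (2 : ℝ) ≤ ENNReal.ofReal (A ^ 2) := by
      refine (setLIntegral_le_lintegral S _).trans ?_
      simpa only [ENNReal.rpow_two] using hA
    calc (∫⁻ x in S, ‖v x‖ₑ ^ (2 : ℝ)) ^ (1 / 2 : ℝ) ≤ (ENNReal.ofReal (A ^ 2)) ^ (1 / 2 : ℝ) :=
          ENNReal.rpow_le_rpow h2 (by norm_num)
      _ = ENNReal.ofReal A := by
          rw [ENNReal.ofReal_rpow_of_nonneg (by positivity) (by norm_num),
            show ((1 : ℝ) / 2) = ((2 : ℕ) : ℝ)⁻¹ by norm_num, Real.pow_rpow_inv_natCast hA0 two_ne_zero]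
  have hF3 : volume S ^ (1 / 3 : ℝ) ≤
      ENNReal.ofReal R * volume (closedBall (0 : EuclideanSpace ℝ (Fin 3)) 1) ^ (1 / 3 : ℝ) := by
    rw [← volume_closedBall_rpow_third hR.le]
    exact ENNReal.rpow_le_rpow (measure_mono inter_subset_right) (by norm_num)
  -- assemble
  calc ‖∫ x, forcePotential g x *
        fderiv ℝ (fun y : EuclideanSpace ℝ (Fin 3) => taoCutoff R r y ^ 8) x (v x)‖ₑ
      ≤ ENNReal.ofReal cω * ENNReal.ofReal (8 * (C₁ / r)) * ∫⁻ x in S, J x * ‖v x‖ₑ := hint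
    _ ≤ ENNReal.ofReal cω * ENNReal.ofReal (8 * (C₁ / r)) *
          ((∫⁻ x in S, J x ^ (6 : ℝ)) ^ (1 / 6 : ℝ) *
            ((∫⁻ x in S, ‖v x‖ₑ ^ (2 : ℝ)) ^ (1 / 2 : ℝ) * volume S ^ (1 / 3 : ℝ))) :=
        mul_le_mul' le_rfl hH
    _ ≤ ENNReal.ofReal cω * ENNReal.ofReal (8 * (C₁ / r)) *
          ((∫⁻ x in {y : EuclideanSpace ℝ (Fin 3) | R * (R - r) ≤ ‖y‖ ^ 2}, J x ^ (6 : ℝ)) ^ (1 / 6 : ℝ) *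
            (ENNReal.ofReal A * (ENNReal.ofReal R *
              volume (closedBall (0 : EuclideanSpace ℝ (Fin 3)) 1) ^ (1 / 3 : ℝ)))) := by
        gcongr
    _ = ENNReal.ofReal (8 * (C₁ / r) * cω * R * A) *
          volume (closedBall (0 : EuclideanSpace ℝ (Fin 3)) 1) ^ (1 / 3 : ℝ) *
          (∫⁻ x in {y : EuclideanSpace ℝ (Fin 3) | R * (R - r) ≤ ‖y‖ ^ 2}, J x ^ (6 : ℝ)) ^ (1 / 6 : ℝ) := by
        have e : ENNReal.ofReal (8 * (C₁ / r) * cω * R * A) =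
            ENNReal.ofReal cω * ENNReal.ofReal (8 * (C₁ / r)) *
              (ENNReal.ofReal A * ENNReal.ofReal R) := by
          rw [← ENNReal.ofReal_mul hcω0, ← ENNReal.ofReal_mul hA0,
            ← ENNReal.ofReal_mul (mul_nonneg hcω0 (by positivity))]
          congr 1
          ring
        rw [e]
        ring

end PotentialSlice

/-! ## 3. Time integration with `L¹`-in-time errors; the work of the force against a running supremum -/

section TimeTools

/-- Time integration of an a.e. slice bound `F(τ) ≤ κ X(τ) + e + g(τ)` over `(0, t)` when the
extra error `g` is only controlled through its LOWER time integral, `∫⁻₀ᵗ g ≤ G < ∞`: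
`∫₀ᵗ F ≤ κ ∫₀ᵗ X + e t + G` (`X ≥ 0` integrable, `κ, e ≥ 0`; neither integrability of `F` nor
measurability of `g` is needed — the Bochner junk value `0` is below the right-hand side).
[folklore] -/
private theorem integral_Ioo_le_of_slice_le_ae_add {F X g : ℝ → ℝ} {t κ e : ℝ} {G : ℝ≥0∞} (ht : 0 ≤ t)
    (hX : IntegrableOn X (Ioo 0 t)) (hX0 : ∀ τ ∈ Ioo 0 t, 0 ≤ X τ) (hκ : 0 ≤ κ) (he : 0 ≤ e)
    (hG : ∫⁻ τ in Ioo 0 t, ENNReal.ofReal (g τ) ≤ G) (hGt : G ≠ ⊤)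
    (h : ∀ᵐ τ ∂(volume.restrict (Ioo 0 t)), F τ ≤ κ * X τ + e + g τ) :
    ∫ τ in Ioo 0 t, F τ ≤ κ * (∫ τ in Ioo 0 t, X τ) + e * t + G.toReal := by
  have ht' : volume (Ioo 0 t) ≠ (⊤ : ℝ≥0∞) := by
    rw [Real.volume_Ioo]; exact ENNReal.ofReal_ne_top
  have hX' : 0 ≤ ∫ τ in Ioo 0 t, X τ := setIntegral_nonneg measurableSet_Ioo hX0
  have hm : IntegrableOn (fun τ => κ * X τ + e) (Ioo 0 t) :=
    (hX.const_mul κ).add (integrableOn_const ht')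
  have hmval : ∫ τ in Ioo 0 t, (κ * X τ + e) = κ * (∫ τ in Ioo 0 t, X τ) + e * t := by
    rw [integral_add (hX.const_mul κ) (integrableOn_const ht'), integral_const_mul,
      setIntegral_const, Real.volume_real_Ioo_of_le ht, smul_eq_mul]
    ring
  by_cases hF : IntegrableOn F (Ioo 0 t)
  · set H : ℝ → ℝ := fun τ => F τ - (κ * X τ + e) with hHdef
    have hH : IntegrableOn H (Ioo 0 t) := hF.sub hm
    have hHp : IntegrableOn (fun τ => max (H τ) 0) (Ioo 0 t) := hH.pos_part
    have hsplit : ∫ τ in Ioo 0 t, F τ = (∫ τ in Ioo 0 t, (κ * X τ + e)) + ∫ τ in Ioo 0 t, H τ := by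
      rw [← integral_add hm hH]
      refine integral_congr_ae (ae_of_all _ fun τ => ?_)
      simp only [hHdef]
      ring
    have h2 : ∫ τ in Ioo 0 t, H τ ≤ G.toReal := by
      calc ∫ τ in Ioo 0 t, H τ ≤ ∫ τ in Ioo 0 t, max (H τ) 0 :=
            integral_mono_ae hH hHp (ae_of_all _ fun τ => le_max_left _ _)
        _ = (∫⁻ τ in Ioo 0 t, ENNReal.ofReal (max (H τ) 0)).toReal :=
            integral_eq_lintegral_of_nonneg_ae (ae_of_all _ fun τ => le_max_right _ _)
              hHp.aestronglyMeasurable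
        _ ≤ G.toReal := by
            refine ENNReal.toReal_mono hGt (le_trans (lintegral_mono_ae ?_) hG)
            filter_upwards [h] with τ hτ
            rcases le_or_gt (H τ) 0 with h0 | h0
            · rw [max_eq_right h0, ENNReal.ofReal_zero]; exact bot_le
            · rw [max_eq_left h0.le]
              refine ENNReal.ofReal_le_ofReal ?_
              simp only [hHdef] at *
              linarith
    rw [hsplit, hmval]
    linarith
  · rw [integral_undef hF]
    have : 0 ≤ G.toReal := ENNReal.toReal_nonneg
    nlinarith

variable {T ν : ℝ} {f u : ℝ → EuclideanSpace ℝ (Fin 3) → EuclideanSpace ℝ (Fin 3)}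
  {p : ℝ → EuclideanSpace ℝ (Fin 3) → ℝ}

/-- **The work of the force on a slice** (Tao: "`X₄ ≲ E_{η⁴}^{1/2} a(t)`", `a(t) = ‖f(t)‖_{L²}`):
`|∫ θ⁸ ⟪g, v⟫| ≤ (2E_{θ⁸}(v))^{1/2} ‖g‖_{L²}` (Cauchy–Schwarz with the weight `θ⁴` on both
factors, `θ⁸ ≤ 1` on the force side), extended-real form (`0 ≤ r`, `0 ≤ R`).
[cite: Tao2011, §8, proof of Lemma 8.1, (61)–(64), the forcing term X₄] -/
theorem enorm_integral_cutoff_inner_le {R r : ℝ} (hR : 0 ≤ R) (hr : 0 ≤ r)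
    {g v : EuclideanSpace ℝ (Fin 3) → EuclideanSpace ℝ (Fin 3)} (hg : Continuous g)
    (hv : Continuous v) :
    ‖∫ x, taoCutoff R r x ^ 8 * ⟪g x, v x⟫‖ₑ ≤
      ENNReal.ofReal (2 * localisedEnergy (fun x => taoCutoff R r x ^ 8) v) ^ (1 / 2 : ℝ) *
        (∫⁻ x, ‖g x‖ₑ ^ 2) ^ (1 / 2 : ℝ) := by
  have hθc : Continuous (taoCutoff (E := EuclideanSpace ℝ (Fin 3)) R r) := continuous_taoCutoff R r
  -- the two Cauchy–Schwarz factors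
  set F₁ : EuclideanSpace ℝ (Fin 3) → ℝ≥0∞ :=
    fun x => ENNReal.ofReal (taoCutoff R r x ^ 4 * ‖v x‖) with hF₁
  set F₂ : EuclideanSpace ℝ (Fin 3) → ℝ≥0∞ :=
    fun x => ENNReal.ofReal (taoCutoff R r x ^ 4 * ‖g x‖) with hF₂
  have hF₁m : AEMeasurable F₁ volume :=
    (((hθc.pow 4).mul hv.norm).measurable.ennreal_ofReal).aemeasurable
  have hF₂m : AEMeasurable F₂ volume :=
    (((hθc.pow 4).mul hg.norm).measurable.ennreal_ofReal).aemeasurable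
  have hpt : ∀ x, ‖taoCutoff R r x ^ 8 * ⟪g x, v x⟫‖ₑ ≤ F₁ x * F₂ x := by
    intro x
    have hθ0 : 0 ≤ taoCutoff R r x ^ 8 := taoCutoff_pow_nonneg R r x 8
    have hθ4 : 0 ≤ taoCutoff R r x ^ 4 := taoCutoff_pow_nonneg R r x 4
    rw [hF₁, hF₂, Real.enorm_eq_ofReal_abs, ← ENNReal.ofReal_mul (mul_nonneg hθ4 (norm_nonneg _))]
    refine ENNReal.ofReal_le_ofReal ?_
    rw [abs_mul, abs_of_nonneg hθ0]
    calc taoCutoff R r x ^ 8 * |⟪g x, v x⟫| ≤ taoCutoff R r x ^ 8 * (‖g x‖ * ‖v x‖) :=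
          mul_le_mul_of_nonneg_left (abs_real_inner_le_norm _ _) hθ0
      _ = taoCutoff R r x ^ 4 * ‖v x‖ * (taoCutoff R r x ^ 4 * ‖g x‖) := by ring
  -- `∫ F₁² = 2 E_{θ⁸}(v)`
  have hint : Integrable (fun x => taoCutoff R r x ^ 8 * ‖v x‖ ^ 2) :=
    ((hθc.pow 8).mul (hv.norm.pow 2)).integrable_of_hasCompactSupport
      ((hasCompactSupport_taoCutoff_pow hR hr (by norm_num : (8 : ℕ) ≠ 0)).mul_right)
  have hE : ∫⁻ x, F₁ x ^ 2 =
      ENNReal.ofReal (2 * localisedEnergy (fun x => taoCutoff R r x ^ 8) v) := by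
    rw [localisedEnergy, show (2 : ℝ) * (2⁻¹ * ∫ x, taoCutoff R r x ^ 8 * ‖v x‖ ^ 2) =
      ∫ x, taoCutoff R r x ^ 8 * ‖v x‖ ^ 2 by ring,
      ofReal_integral_eq_lintegral_ofReal hint (ae_of_all _ fun x =>
        mul_nonneg (taoCutoff_pow_nonneg R r x 8) (sq_nonneg _))]
    refine lintegral_congr fun x => ?_
    rw [hF₁, ← ENNReal.ofReal_pow (mul_nonneg (taoCutoff_pow_nonneg R r x 4) (norm_nonneg _))]
    congr 1
    ring
  have hG : ∫⁻ x, F₂ x ^ 2 ≤ ∫⁻ x, ‖g x‖ₑ ^ 2 := by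
    refine lintegral_mono fun x => ?_
    rw [hF₂, ← ENNReal.ofReal_pow (mul_nonneg (taoCutoff_pow_nonneg R r x 4) (norm_nonneg _)),
      ← ofReal_norm, ← ENNReal.ofReal_pow (norm_nonneg _)]
    refine ENNReal.ofReal_le_ofReal ?_
    have h1 : taoCutoff R r x ^ 4 ≤ 1 := taoCutoff_pow_le_one R r x 4
    have h0 : 0 ≤ taoCutoff R r x ^ 4 := taoCutoff_pow_nonneg R r x 4
    calc (taoCutoff R r x ^ 4 * ‖g x‖) ^ 2 = (taoCutoff R r x ^ 4) ^ 2 * ‖g x‖ ^ 2 := by ring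
      _ ≤ 1 ^ 2 * ‖g x‖ ^ 2 := by gcongr
      _ = ‖g x‖ ^ 2 := by ring
  calc ‖∫ x, taoCutoff R r x ^ 8 * ⟪g x, v x⟫‖ₑ
      ≤ ∫⁻ x, ‖taoCutoff R r x ^ 8 * ⟪g x, v x⟫‖ₑ := enorm_integral_le_lintegral_enorm _
    _ ≤ ∫⁻ x, F₁ x * F₂ x := lintegral_mono hpt
    _ ≤ (∫⁻ x, F₁ x ^ 2) ^ (1 / 2 : ℝ) * (∫⁻ x, F₂ x ^ 2) ^ (1 / 2 : ℝ) :=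
        lintegral_mul_le_sqrt_mul_sqrt hF₁m hF₂m
    _ ≤ ENNReal.ofReal (2 * localisedEnergy (fun x => taoCutoff R r x ^ 8) v) ^ (1 / 2 : ℝ) *
          (∫⁻ x, ‖g x‖ₑ ^ 2) ^ (1 / 2 : ℝ) := by
        rw [hE]
        gcongr

/-- **The work of the force in time against a running supremum of the localised energy**
(Tao's "`∂ₜ(E_{η⁴} + E)^{1/2} ≲ … + a(t)`, `∫₀ᵀ a ≲ E^{1/2}`" in integrated form): if
`E_{θ⁸}(u(τ)) ≤ M` on `(0, t)`, then `|∫₀ᵗ∫θ⁸⟪f,u⟫| ≤ (2M)^{1/2} Λ`, `Λ ≥ ∫₀ᵀ‖f(τ)‖_{L²} dτ`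
(lower time integrals of the slice norms; no uniform slice bound on `f` is used).
[cite: Tao2011, §8, proof of Lemma 8.1, (64)–(65), the forcing term X₄] -/
theorem IsClassicalNSSolutionOn.abs_integral_cutoff_work_le
    (h : IsClassicalNSSolutionOn (Icc 0 T) ν f u p) (hT : 0 < T) {R r : ℝ} (hR : 0 ≤ R) (hr : 0 ≤ r)
    {t : ℝ} (ht : t ∈ Icc 0 T) {M : ℝ}
    (hM : ∀ τ ∈ Ioo 0 t, localisedEnergy (fun x => taoCutoff R r x ^ 8) (u τ) ≤ M) {Λ : ℝ≥0∞}
    (hΛ : ∫⁻ τ in Icc 0 T, (∫⁻ x, ‖f τ x‖ₑ ^ 2) ^ (1 / 2 : ℝ) ≤ Λ) (hΛt : Λ ≠ ⊤) :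
    |∫ τ in Ioo 0 t, ∫ x, taoCutoff R r x ^ 8 * ⟪f τ x, u τ x⟫| ≤ Real.sqrt (2 * M) * Λ.toReal := by
  have hU : UniqueDiffOn ℝ (Icc 0 T) := uniqueDiffOn_Icc hT
  have hI : ∀ {τ}, τ ∈ Ioo 0 t → τ ∈ Icc 0 T := fun hτ => ⟨hτ.1.le, hτ.2.le.trans ht.2⟩
  have hslice : ∀ τ ∈ Ioo 0 t, ‖∫ x, taoCutoff R r x ^ 8 * ⟪f τ x, u τ x⟫‖ₑ ≤
      ENNReal.ofReal (Real.sqrt (2 * M)) * (∫⁻ x, ‖f τ x‖ₑ ^ 2) ^ (1 / 2 : ℝ) := by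
    intro τ hτ
    refine (enorm_integral_cutoff_inner_le hR hr (h.continuous_force_slice hU (hI hτ))
      (h.contDiff_velocity (hI hτ)).continuous).trans ?_
    gcongr
    have hE0 : 0 ≤ 2 * localisedEnergy (fun x => taoCutoff R r x ^ 8) (u τ) :=
      mul_nonneg zero_le_two (localisedEnergy_nonneg (fun x => taoCutoff_pow_nonneg R r x 8) _)
    rw [ENNReal.ofReal_rpow_of_nonneg hE0 (by norm_num), ← Real.sqrt_eq_rpow]
    exact ENNReal.ofReal_le_ofReal (Real.sqrt_le_sqrt (by linarith [hM τ hτ]))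
  have hle : ∫⁻ τ in Ioo 0 t, ‖∫ x, taoCutoff R r x ^ 8 * ⟪f τ x, u τ x⟫‖ₑ ≤
      ENNReal.ofReal (Real.sqrt (2 * M)) * Λ := by
    calc ∫⁻ τ in Ioo 0 t, ‖∫ x, taoCutoff R r x ^ 8 * ⟪f τ x, u τ x⟫‖ₑ
        ≤ ∫⁻ τ in Ioo 0 t, ENNReal.ofReal (Real.sqrt (2 * M)) * (∫⁻ x, ‖f τ x‖ₑ ^ 2) ^ (1 / 2 : ℝ) :=
          setLIntegral_mono' measurableSet_Ioo hslice
      _ = ENNReal.ofReal (Real.sqrt (2 * M)) * ∫⁻ τ in Ioo 0 t, (∫⁻ x, ‖f τ x‖ₑ ^ 2) ^ (1 / 2 : ℝ) :=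
          lintegral_const_mul' _ _ ENNReal.ofReal_ne_top
      _ ≤ ENNReal.ofReal (Real.sqrt (2 * M)) * Λ := by
          gcongr
          exact (lintegral_mono_set (Ioo_subset_Icc_self.trans (Icc_subset_Icc_right ht.2))).trans hΛ
  have h1 := norm_integral_le_lintegral_norm (μ := volume.restrict (Ioo 0 t))
    fun τ => ∫ x, taoCutoff R r x ^ 8 * ⟪f τ x, u τ x⟫
  rw [Real.norm_eq_abs] at h1
  refine h1.trans ?_
  have h2 : ∫⁻ τ in Ioo 0 t, ENNReal.ofReal ‖∫ x, taoCutoff R r x ^ 8 * ⟪f τ x, u τ x⟫‖ ≤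
      ENNReal.ofReal (Real.sqrt (2 * M)) * Λ :=
    le_trans (lintegral_mono fun τ => by rw [ofReal_norm]) hle
  refine (ENNReal.toReal_mono (ENNReal.mul_ne_top ENNReal.ofReal_ne_top hΛt) h2).trans_eq ?_
  rw [ENNReal.toReal_mul, ENNReal.toReal_ofReal (Real.sqrt_nonneg _)]

/-- Absorbing the running supremum: `M ≤ B + (2M)^{1/2} Λ` with `M, B, Λ ≥ 0` forces
`M ≤ 2B + 2Λ²` (AM–GM: `(2M)^{1/2}Λ ≤ M/2 + Λ²`; `M ≥ 0`). [folklore] -/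
private theorem le_of_le_add_sqrt_two_mul {M B Λ : ℝ} (hM : 0 ≤ M)
    (h : M ≤ B + Real.sqrt (2 * M) * Λ) : M ≤ 2 * B + 2 * Λ ^ 2 := by
  have hs : Real.sqrt (2 * M) ^ 2 = 2 * M := Real.sq_sqrt (by linarith)
  nlinarith [sq_nonneg (Real.sqrt (2 * M) - 2 * Λ), Real.sqrt_nonneg (2 * M)]

/-- The same AM–GM step for the final bound: `B + (2M)^{1/2}Λ ≤ 2B + 2Λ²` once `M ≤ 2B + 2Λ²`
(`M ≥ 0`). [folklore] -/
private theorem add_sqrt_two_mul_le {M B Λ : ℝ} (hM : 0 ≤ M)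
    (h : M ≤ 2 * B + 2 * Λ ^ 2) : B + Real.sqrt (2 * M) * Λ ≤ 2 * B + 2 * Λ ^ 2 := by
  have hs : Real.sqrt (2 * M) ^ 2 = 2 * M := Real.sq_sqrt (by linarith)
  nlinarith [sq_nonneg (Real.sqrt (2 * M) - 2 * Λ), Real.sqrt_nonneg (2 * M)]

end TimeTools

/-! ## 4. The force-potential error vanishes as `R → ∞` (dominated convergence in time) -/

section TailLimit

variable {T : ℝ} {f : ℝ → EuclideanSpace ℝ (Fin 3) → EuclideanSpace ℝ (Fin 3)}

/-- Joint a.e.-measurability of `(τ, x) ↦ I₁|f(τ)|(x)` on `[0,T] × ℝ³` for a force continuous on the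
closed slab (Tonelli for the lower integral in `y` of the jointly measurable
`|f(τ,y)| |x - y|^{-2}`). [folklore] -/
private theorem aemeasurable_rieszPotential_uncurry
    (hf : ContinuousOn (uncurry f) (Icc 0 T ×ˢ univ)) :
    AEMeasurable (fun q : ℝ × EuclideanSpace ℝ (Fin 3) =>
        rieszPotential volume 1 (fun y => ‖f q.1 y‖ₑ) q.2)
      (((volume : Measure ℝ).restrict (Icc 0 T)).prod (volume : Measure (EuclideanSpace ℝ (Fin 3)))) := by
  set μ2 : Measure (ℝ × EuclideanSpace ℝ (Fin 3)) :=
    ((volume : Measure ℝ).restrict (Icc 0 T)).prod (volume : Measure (EuclideanSpace ℝ (Fin 3)))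
    with hμ2
  have hF : AEMeasurable (fun p : (ℝ × EuclideanSpace ℝ (Fin 3)) × EuclideanSpace ℝ (Fin 3) =>
      f p.1.1 p.2) (μ2.prod volume) := by
    have hcont : ContinuousOn (fun p : (ℝ × EuclideanSpace ℝ (Fin 3)) × EuclideanSpace ℝ (Fin 3) =>
        f p.1.1 p.2) ((Icc 0 T ×ˢ univ) ×ˢ univ) := by
      have hg : Continuous (fun p : (ℝ × EuclideanSpace ℝ (Fin 3)) × EuclideanSpace ℝ (Fin 3) =>
          (p.1.1, p.2)) := by fun_prop
      exact hf.comp hg.continuousOn (fun p hp => ⟨hp.1.1, mem_univ _⟩)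
    have hμ : μ2.prod volume = (((volume : Measure ℝ).prod
        (volume : Measure (EuclideanSpace ℝ (Fin 3)))).prod
        (volume : Measure (EuclideanSpace ℝ (Fin 3)))).restrict ((Icc 0 T ×ˢ univ) ×ˢ univ) := by
      rw [hμ2, Measure.restrict_prod_eq_prod_univ, Measure.restrict_prod_eq_prod_univ]
    rw [hμ]
    exact hcont.aemeasurable ((measurableSet_Icc.prod MeasurableSet.univ).prod MeasurableSet.univ)
  have hK : Measurable (fun p : (ℝ × EuclideanSpace ℝ (Fin 3)) × EuclideanSpace ℝ (Fin 3) =>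
      ENNReal.ofReal (‖p.1.2 - p.2‖ ^
        ((1 : ℝ) - (Module.finrank ℝ (EuclideanSpace ℝ (Fin 3)) : ℝ)))) :=
    ENNReal.measurable_ofReal.comp ((measurable_fst.snd.sub measurable_snd).norm.pow_const _)
  have hprod : AEMeasurable (fun p : (ℝ × EuclideanSpace ℝ (Fin 3)) × EuclideanSpace ℝ (Fin 3) =>
      ‖f p.1.1 p.2‖ₑ * ENNReal.ofReal (‖p.1.2 - p.2‖ ^
        ((1 : ℝ) - (Module.finrank ℝ (EuclideanSpace ℝ (Fin 3)) : ℝ)))) (μ2.prod volume) :=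
    hF.enorm.mul hK.aemeasurable
  have h := hprod.lintegral_prod_right'
  exact h.congr (ae_of_all _ fun q => rfl)

/-- A.e.-measurability in time of the tail functional
`τ ↦ ‖I₁|f(τ)|‖_{L⁶(S)} = (∫_S (I₁|f(τ)|)⁶)^{1/6}` on `[0,T]`, for a measurable set `S`. [folklore] -/
private theorem aemeasurable_tail_rieszPotential
    (hf : ContinuousOn (uncurry f) (Icc 0 T ×ˢ univ)) {S : Set (EuclideanSpace ℝ (Fin 3))}
    (hS : MeasurableSet S) :
    AEMeasurable (fun τ => (∫⁻ x in S, rieszPotential volume 1 (fun y => ‖f τ y‖ₑ) x ^ (6 : ℝ)) ^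
        (1 / 6 : ℝ)) ((volume : Measure ℝ).restrict (Icc 0 T)) := by
  have hJ := aemeasurable_rieszPotential_uncurry hf
  have h6 : AEMeasurable (fun q : ℝ × EuclideanSpace ℝ (Fin 3) =>
      (Prod.snd ⁻¹' S).indicator (fun q : ℝ × EuclideanSpace ℝ (Fin 3) =>
        rieszPotential volume 1 (fun y => ‖f q.1 y‖ₑ) q.2 ^ (6 : ℝ)) q)
      (((volume : Measure ℝ).restrict (Icc 0 T)).prod (volume : Measure (EuclideanSpace ℝ (Fin 3)))) :=
    (hJ.pow_const _).indicator (measurable_snd hS)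
  have h7 := h6.lintegral_prod_right'
  have e : ∀ τ : ℝ, ∫⁻ x, (Prod.snd ⁻¹' S).indicator (fun q : ℝ × EuclideanSpace ℝ (Fin 3) =>
      rieszPotential volume 1 (fun y => ‖f q.1 y‖ₑ) q.2 ^ (6 : ℝ)) (τ, x) =
      ∫⁻ x in S, rieszPotential volume 1 (fun y => ‖f τ y‖ₑ) x ^ (6 : ℝ) := by
    intro τ
    rw [← lintegral_indicator hS]
    exact lintegral_congr fun x => rfl
  simp_rw [e] at h7
  exact h7.pow_const _

/-- A.e.-measurability in time of the slice norms `τ ↦ ‖f(τ)‖_{L²} = (∫|f(τ)|²)^{1/2}` on `[0,T]`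
(Tonelli). [folklore] -/
private theorem aemeasurable_lintegral_force_sq_rpow
    (hf : ContinuousOn (uncurry f) (Icc 0 T ×ˢ univ)) :
    AEMeasurable (fun τ => (∫⁻ x, ‖f τ x‖ₑ ^ 2) ^ (1 / 2 : ℝ))
      ((volume : Measure ℝ).restrict (Icc 0 T)) := by
  have h1 : AEMeasurable (fun q : ℝ × EuclideanSpace ℝ (Fin 3) => ‖f q.1 q.2‖ₑ ^ 2)
      (((volume : Measure ℝ).restrict (Icc 0 T)).prod (volume : Measure (EuclideanSpace ℝ (Fin 3)))) := by
    rw [Measure.restrict_prod_eq_prod_univ]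
    exact ((hf.aemeasurable (measurableSet_Icc.prod MeasurableSet.univ)).enorm.pow_const 2)
  exact h1.lintegral_prod_right'.pow_const _

/-- **The force-potential error vanishes in the limit `R → ∞`** (`R = n + 1`, `r = R/4`, shell
inner radius² `R(R - r)`): `Ψ_n = ∫₀ᵀ ‖I₁|f(τ)|‖_{L⁶(|x|² ≥ R(R-r))} dτ → 0`, by dominated
convergence in `τ` — the integrand is dominated by `C_{HLS}‖f(τ)‖_{L²} ∈ L¹(0,T)` (Hardy–Littlewood–
Sobolev) and tends to `0` for a.e. `τ` (the tails of the `L⁶` function `I₁|f(τ)|`, dominated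
convergence in `x`). This is the only place where `∫₀ᵀ‖f‖_{L²} < ∞` enters beyond the work term.
[cite: Tao2011, §8, proof of Lemma 8.1, (54) with (9): the forcing symmetry replaced by Lemma 4.1 (i)] -/
theorem tendsto_lintegral_tail_rieszPotential (hf : IsSmoothSpaceTimeOn (Icc 0 T) f)
    (hfE : ∫⁻ t in Icc 0 T, (∫⁻ x, ‖f t x‖ₑ ^ 2) ^ (1 / 2 : ℝ) < ⊤) :
    Tendsto (fun n : ℕ => ∫⁻ τ in Ioo 0 T,
      (∫⁻ x in {y : EuclideanSpace ℝ (Fin 3) |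
          ((n : ℝ) + 1) * (((n : ℝ) + 1) - ((n : ℝ) + 1) / 4) ≤ ‖y‖ ^ 2},
        rieszPotential volume 1 (fun y => ‖f τ y‖ₑ) x ^ (6 : ℝ)) ^ (1 / 6 : ℝ)) atTop (𝓝 0) := by
  obtain ⟨CH, hCH, hHLS⟩ := exists_hls_one_two_six
  have hfc : ContinuousOn (uncurry f) (Icc 0 T ×ˢ univ) := hf.continuousOn
  set far : ℕ → Set (EuclideanSpace ℝ (Fin 3)) := fun n =>
    {y | ((n : ℝ) + 1) * (((n : ℝ) + 1) - ((n : ℝ) + 1) / 4) ≤ ‖y‖ ^ 2} with hfar_def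
  have hfar : ∀ n, MeasurableSet (far n) := fun n =>
    measurableSet_le measurable_const (continuous_norm.pow 2).measurable
  set J : ℝ → EuclideanSpace ℝ (Fin 3) → ℝ≥0∞ := fun τ =>
    rieszPotential volume 1 (fun y => ‖f τ y‖ₑ) with hJ_def
  set G : ℕ → ℝ → ℝ≥0∞ := fun n τ => (∫⁻ x in far n, J τ x ^ (6 : ℝ)) ^ (1 / 6 : ℝ) with hG_def
  -- measurability in `τ`
  have hGm : ∀ n, AEMeasurable (G n) ((volume : Measure ℝ).restrict (Ioo 0 T)) := fun n =>
    (aemeasurable_tail_rieszPotential hfc (hfar n)).mono_measure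
      (Measure.restrict_mono Ioo_subset_Icc_self le_rfl)
  -- the slices of `f` on the slab
  have hslab : ∀ τ ∈ Ioo 0 T, Continuous (f τ) := fun τ hτ =>
    (hf.contDiff_slice (Ioo_subset_Icc_self hτ)).continuous
  -- domination by `C_H ‖f(τ)‖_{L²}` (Hardy–Littlewood–Sobolev)
  set bound : ℝ → ℝ≥0∞ := fun τ => CH * (∫⁻ x, ‖f τ x‖ₑ ^ 2) ^ (1 / 2 : ℝ) with hbound_def
  have hJ6 : ∀ τ ∈ Ioo 0 T, (∫⁻ x, J τ x ^ (6 : ℝ)) ^ (1 / 6 : ℝ) ≤ bound τ := by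
    intro τ hτ
    have h := hHLS _ (hslab τ hτ).measurable.enorm.aemeasurable
    simp only [ENNReal.rpow_two] at h
    exact h
  have hGle : ∀ n, ∀ τ ∈ Ioo 0 T, G n τ ≤ bound τ := fun n τ hτ =>
    (ENNReal.rpow_le_rpow (setLIntegral_le_lintegral _ _) (by norm_num)).trans (hJ6 τ hτ)
  have h_bound : ∀ n, ∀ᵐ τ ∂((volume : Measure ℝ).restrict (Ioo 0 T)), G n τ ≤ bound τ := fun n =>
    (ae_restrict_iff' measurableSet_Ioo).2 (ae_of_all _ (hGle n))
  have h_fin : ∫⁻ τ in Ioo 0 T, bound τ ≠ ⊤ := by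
    have e : ∫⁻ τ in Ioo 0 T, bound τ =
        CH * ∫⁻ τ in Ioo 0 T, (∫⁻ x, ‖f τ x‖ₑ ^ 2) ^ (1 / 2 : ℝ) :=
      lintegral_const_mul' _ _ hCH.ne
    rw [e]
    exact ENNReal.mul_ne_top hCH.ne (((lintegral_mono_set Ioo_subset_Icc_self).trans_lt hfE).ne)
  -- the slice energies of `f` are finite for a.e. `τ`
  have hfin_ae : ∀ᵐ τ ∂((volume : Measure ℝ).restrict (Ioo 0 T)),
      (∫⁻ x, ‖f τ x‖ₑ ^ 2) ^ (1 / 2 : ℝ) < ⊤ :=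
    ae_restrict_of_ae_restrict_of_subset Ioo_subset_Icc_self
      (ae_lt_top' (aemeasurable_lintegral_force_sq_rpow hfc) hfE.ne)
  -- pointwise limit
  have h_lim : ∀ᵐ τ ∂((volume : Measure ℝ).restrict (Ioo 0 T)),
      Tendsto (fun n => G n τ) atTop (𝓝 0) := by
    filter_upwards [hfin_ae, ae_restrict_mem measurableSet_Ioo] with τ hτfin hτ
    have hbt : bound τ < ⊤ := ENNReal.mul_lt_top hCH hτfin
    have hI6 : ∫⁻ x, J τ x ^ (6 : ℝ) < ⊤ :=
      (ENNReal.rpow_lt_top_iff_of_pos (by norm_num : (0 : ℝ) < 1 / 6)).1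
        ((hJ6 τ hτ).trans_lt hbt)
    have hJm : Measurable (J τ) := measurable_rieszPotential volume 1 (hslab τ hτ).measurable.enorm
    have htail : Tendsto (fun n => ∫⁻ x in far n, J τ x ^ (6 : ℝ)) atTop (𝓝 0) := by
      have hdc := tendsto_lintegral_of_dominated_convergence (μ := (volume : Measure (EuclideanSpace ℝ (Fin 3))))
        (F := fun n x => (far n).indicator (fun x => J τ x ^ (6 : ℝ)) x) (f := fun _ => 0)
        (fun x => J τ x ^ (6 : ℝ)) (fun n => ((hJm.pow_const _).indicator (hfar n)))
        (fun n => ae_of_all _ fun x => indicator_le_self _ _ x) hI6.ne ?_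
      · simpa only [lintegral_indicator (hfar _), lintegral_zero] using hdc
      refine ae_of_all _ fun x => ?_
      have hev : ∀ᶠ n : ℕ in atTop, x ∉ far n := by
        filter_upwards [tendsto_natCast_atTop_atTop.eventually_ge_atTop (2 * ‖x‖ ^ 2)] with n hn
        simp only [hfar_def, mem_setOf_eq, not_le]
        nlinarith [sq_nonneg ‖x‖]
      refine tendsto_const_nhds.congr' ?_
      filter_upwards [hev] with n hn
      rw [indicator_of_notMem hn]
    have h0 : Tendsto (fun s : ℝ≥0∞ => s ^ (1 / 6 : ℝ)) (𝓝 0) (𝓝 0) := by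
      have := (ENNReal.continuous_rpow_const (y := (1 / 6 : ℝ))).tendsto 0
      simpa [ENNReal.zero_rpow_of_pos (by norm_num : (0 : ℝ) < 1 / 6)] using this
    exact h0.comp htail
  have h := tendsto_lintegral_of_dominated_convergence' bound hGm h_bound h_fin h_lim
  simpa only [lintegral_zero] using h

end TailLimit

/-! ## 5. The localised energy inequality WITH an `L¹_t L²_x` force (Tao (61)–(65), integrated) -/

section Localised

variable {T ν : ℝ} {f u : ℝ → EuclideanSpace ℝ (Fin 3) → EuclideanSpace ℝ (Fin 3)}
  {p : ℝ → EuclideanSpace ℝ (Fin 3) → ℝ}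

/-- The compactly supported weight `x ↦ Dφ(x)(v x)` for a compactly supported `C¹` cut-off `φ`
and a field `v`: compact support. [folklore] -/
private theorem hasCompactSupport_fderiv_apply {φ : EuclideanSpace ℝ (Fin 3) → ℝ}
    (hφc : HasCompactSupport φ) (v : EuclideanSpace ℝ (Fin 3) → EuclideanSpace ℝ (Fin 3)) :
    HasCompactSupport fun x => fderiv ℝ φ x (v x) := by
  refine (hφc.fderiv ℝ).mono fun x hx => ?_
  rw [Function.mem_support] at hx ⊢
  contrapose! hx
  rw [hx]
  rfl

/-- Bookkeeping of (65) integrated in time, WITH force: the localised identity plus the absorbed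
slice bounds, the force-potential error `e_Φ` and the work bound `W` give
`E(t) + (ν/2)∫₀ᵗ X₁ ≤ E(0) + (e_a + e_b + e_c) t + e_Φ + W`. [folklore] -/
private theorem energy_assembly_arith_forced_integrable
    {Et E0 I₃ I₁ I₂ IP If ν t ea eb ec eΦ W : ℝ}
    (hid : 2⁻¹ * Et - 2⁻¹ * E0 = 2⁻¹ * I₃ - ν * I₁ - ν * I₂ + IP + If)
    (ha : 2⁻¹ * I₃ ≤ ν / 8 * I₁ + ea * t) (hb : -ν * I₂ ≤ ν / 8 * I₁ + eb * t)
    (hc : IP ≤ ν / 4 * I₁ + ec * t + eΦ) (hIf : If ≤ W) :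
    2⁻¹ * Et + ν / 2 * I₁ ≤ 2⁻¹ * E0 + (ea + eb + ec) * t + eΦ + W := by
  have e : (ea + eb + ec) * t = ea * t + eb * t + ec * t := by ring
  rw [e]
  linarith

/-- **One time step of (61)–(65) WITH an `L¹_t L²_x` force, against a bound `M` of the localised
energy.** For a classical solution on `[0,T] × ℝ³` with `∫|u(t)|² ≤ A²`, the cut-off `θ = θ_{R,r}`
with `R = 4r`, the forced pressure representation `p = p̃[u] + Δ⁻¹∇·f + C(τ)` for a.e. `τ` (Lemma
4.1 (i) WITH force), the estimate of `X₅`, and a bound `E_{θ⁸}(u(τ)) ≤ M` on `(0,t)`: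
`E_{θ⁸}(u(t)) + (ν/2)∫₀ᵗ∫θ⁸|∇u|² ≤ E_{θ⁸}(u₀) + e_r t + K_Φ A Ψ + (2M)^{1/2} Λ`, where `e_r` collects
the error constants of (62)–(64) at radius ratio `r`, `Ψ ≥ ∫₀ᵀ‖I₁|f(τ)|‖_{L⁶(|x|² ≥ R(R-r))} dτ` is the
force-potential tail of §2/§4 with `K_Φ = 32 C₁ ω₃⁻¹ |B̄₁|^{1/3}`, and `Λ ≥ ∫₀ᵀ‖f(τ)‖_{L²} dτ`.
[cite: Tao2011, §8, proof of Lemma 8.1, (61)–(65) with (54)] -/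
theorem IsClassicalNSSolutionOn.localisedEnergy_step_forced
    (h : IsClassicalNSSolutionOn (Icc 0 T) ν f u p) (hν : 0 < ν) (hT : 0 < T)
    (hf : IsSmoothSpaceTimeOn (Icc 0 T) f)
    {A : ℝ} (hA0 : 0 ≤ A) (hEA : ∀ t ∈ Icc 0 T, ∫⁻ x, ‖u t x‖ₑ ^ 2 ≤ ENNReal.ofReal (A ^ 2))
    {C₅ : ℝ} (hC₅0 : 0 ≤ C₅)
    (hC₅ : ∀ v : EuclideanSpace ℝ (Fin 3) → EuclideanSpace ℝ (Fin 3), ContDiff ℝ (↑(⊤ : ℕ∞)) v →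
      ∀ A : ℝ, 0 ≤ A → ∫⁻ x, ‖v x‖ₑ ^ 2 ≤ ENNReal.ofReal (A ^ 2) →
      ∀ (R r : ℝ), 0 < r → 2 * r < R → ∀ ε : ℝ, 0 < ε →
        |∫ x, normalisedPressure v x *
            fderiv ℝ (fun y : EuclideanSpace ℝ (Fin 3) => taoCutoff R r y ^ 8) x (v x)| ≤
          ε * localisedDissipation (fun x => taoCutoff R r x ^ 8) v +
            C₅ * (ε * A ^ 2 / r ^ 2 + A ^ 6 / (ε ^ 3 * r ^ 4)))
    {R r C₁ : ℝ} (hr : 0 < r) (hRr4 : R = 4 * r)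
    (hCθ : ∀ x : EuclideanSpace ℝ (Fin 3), ‖fderiv ℝ (taoCutoff R r) x‖ ≤ C₁ / r) (hC₁0 : 0 ≤ C₁)
    {Cp : ℝ → ℝ}
    (hae : ∀ᵐ τ ∂((volume : Measure ℝ).restrict (Icc 0 T)), ∀ x,
      p τ x = normalisedPressure (u τ) x + forcePotential (f τ) x + Cp τ)
    {Ψ Λ : ℝ≥0∞} (hΨt : Ψ ≠ ⊤)
    (hΨ : ∫⁻ τ in Ioo 0 T, (∫⁻ x in {y : EuclideanSpace ℝ (Fin 3) | R * (R - r) ≤ ‖y‖ ^ 2},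
        rieszPotential volume 1 (fun y => ‖f τ y‖ₑ) x ^ (6 : ℝ)) ^ (1 / 6 : ℝ) ≤ Ψ)
    (hfin : ∀ᵐ τ ∂((volume : Measure ℝ).restrict (Icc 0 T)), ∫⁻ x, ‖f τ x‖ₑ ^ 2 < ⊤)
    (hGfin : ∀ᵐ τ ∂((volume : Measure ℝ).restrict (Icc 0 T)),
      (∫⁻ x in {y : EuclideanSpace ℝ (Fin 3) | R * (R - r) ≤ ‖y‖ ^ 2},
        rieszPotential volume 1 (fun y => ‖f τ y‖ₑ) x ^ (6 : ℝ)) ^ (1 / 6 : ℝ) < ⊤)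
    (hΛ : ∫⁻ τ in Icc 0 T, (∫⁻ x, ‖f τ x‖ₑ ^ 2) ^ (1 / 2 : ℝ) ≤ Λ) (hΛt : Λ ≠ ⊤)
    {t : ℝ} (ht : t ∈ Icc 0 T) {M : ℝ}
    (hM : ∀ τ ∈ Ioo 0 t, localisedEnergy (fun x => taoCutoff R r x ^ 8) (u τ) ≤ M) :
    localisedEnergy (fun x => taoCutoff R r x ^ 8) (u t) +
        ν / 2 * (∫ τ in Ioo 0 t, localisedDissipation
          (fun x : EuclideanSpace ℝ (Fin 3) => taoCutoff R r x ^ 8) (u τ)) ≤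
      localisedEnergy (fun x => taoCutoff R r x ^ 8) (u 0) +
        ((386 * C₁ ^ 2 + C₅ / 4) * (ν * A ^ 2 / r ^ 2) +
          (1048576 * C₁ ^ 4 * gnsConst3 ^ 6 + 64 * C₅) * (A ^ 6 / (ν ^ 3 * r ^ 4))) * t +
        32 * C₁ * (unitSphereArea (EuclideanSpace ℝ (Fin 3)))⁻¹ *
            (volume (closedBall (0 : EuclideanSpace ℝ (Fin 3)) 1) ^ (1 / 3 : ℝ)).toReal * A *
          Ψ.toReal +
        Real.sqrt (2 * M) * Λ.toReal := by
  have hK0 : 0 ≤ gnsConst3 := gnsConst3_nonneg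
  have hR : 0 < R := by rw [hRr4]; positivity
  have hrR : 2 * r < R := by rw [hRr4]; linarith
  have hφ1 : ContDiff ℝ 1 fun x : EuclideanSpace ℝ (Fin 3) => taoCutoff R r x ^ 8 :=
    contDiff_taoCutoff_pow R r 8
  have hφc : HasCompactSupport fun x : EuclideanSpace ℝ (Fin 3) => taoCutoff R r x ^ 8 :=
    hasCompactSupport_taoCutoff_pow hR.le hr.le (by norm_num)
  -- the constant of the force-potential term
  set V₁ : ℝ≥0∞ := volume (closedBall (0 : EuclideanSpace ℝ (Fin 3)) 1) with hV₁_def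
  have hV₁t : V₁ ≠ ⊤ := measure_closedBall_lt_top.ne
  have hV3t : V₁ ^ (1 / 3 : ℝ) ≠ ⊤ := ENNReal.rpow_ne_top_of_nonneg (by norm_num) hV₁t
  have hω : 0 < unitSphereArea (EuclideanSpace ℝ (Fin 3)) := unitSphereArea_pos
  set cω : ℝ := (unitSphereArea (EuclideanSpace ℝ (Fin 3)))⁻¹ with hcω_def
  have hcω0 : 0 ≤ cω := inv_nonneg.2 hω.le
  set KΦ : ℝ := 32 * C₁ * cω * (V₁ ^ (1 / 3 : ℝ)).toReal with hKΦ_def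
  have hKΦ0 : 0 ≤ KΦ := by positivity
  have hKΦe : ENNReal.ofReal (8 * (C₁ / r) * cω * R * A) * V₁ ^ (1 / 3 : ℝ) =
      ENNReal.ofReal (KΦ * A) := by
    have e1 : 8 * (C₁ / r) * cω * R * A = 32 * C₁ * cω * A := by
      rw [hRr4]
      field_simp
      ring
    have h32 : 0 ≤ 32 * C₁ * cω * A := by positivity
    have e2 : KΦ * A = (32 * C₁ * cω * A) * (V₁ ^ (1 / 3 : ℝ)).toReal := by
      rw [hKΦ_def]; ring
    rw [e1, e2, ENNReal.ofReal_mul h32, ENNReal.ofReal_toReal hV3t]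
  -- the tail functional
  set G : ℝ → ℝ≥0∞ := fun τ => (∫⁻ x in {y : EuclideanSpace ℝ (Fin 3) | R * (R - r) ≤ ‖y‖ ^ 2},
    rieszPotential volume 1 (fun y => ‖f τ y‖ₑ) x ^ (6 : ℝ)) ^ (1 / 6 : ℝ) with hG_def
  -- slices
  have hI : ∀ {τ : ℝ}, τ ∈ Ioo 0 t → τ ∈ Icc 0 T := fun hτ => ⟨hτ.1.le, hτ.2.le.trans ht.2⟩
  have hslab : ∀ τ ∈ Icc 0 T, Continuous (f τ) := fun τ hτ => (hf.contDiff_slice hτ).continuous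
  have hv1 : ∀ τ ∈ Icc 0 T, ContDiff ℝ 1 (u τ) := fun τ hτ =>
    (h.contDiff_velocity hτ).of_le (by exact_mod_cast le_top)
  have hint : ∀ τ ∈ Icc 0 T, Integrable fun x => ‖u τ x‖ ^ 2 := fun τ hτ =>
    integrable_sq_of_lintegral_enorm_sq_lt_top (h.contDiff_velocity hτ).continuous
      ((hEA τ hτ).trans_lt ENNReal.ofReal_lt_top)
  have hA2 : ∀ τ ∈ Icc 0 T, ∫ x, ‖u τ x‖ ^ 2 ≤ A ^ 2 := by
    intro τ hτ
    have h' := hEA τ hτ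
    rw [← ofReal_integral_norm_sq_eq_lintegral (hint τ hτ)] at h'
    exact (ENNReal.ofReal_le_ofReal_iff (by positivity)).1 h'
  -- the localised dissipation in time
  have hX0 : ∀ τ ∈ Ioo 0 t, 0 ≤ localisedDissipation
      (fun x : EuclideanSpace ℝ (Fin 3) => taoCutoff R r x ^ 8) (u τ) :=
    fun τ _ => localisedDissipation_nonneg (fun x => taoCutoff_pow_nonneg R r x 8) _
  have hXi : IntegrableOn (fun τ => localisedDissipation
      (fun x : EuclideanSpace ℝ (Fin 3) => taoCutoff R r x ^ 8) (u τ)) (Ioo 0 t) :=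
    ((continuousOn_localisedDissipation h.smooth_velocity hT
      ((continuous_taoCutoff R r).pow 8) (isCompact_closedBall 0 R)
      (support_taoCutoff_pow_subset hR.le hr.le (by norm_num))).integrableOn_Icc).mono_set
      (Ioo_subset_Icc_self.trans (Icc_subset_Icc_right ht.2))
  -- (61) integrated over `(0, t)`
  have hid := h.energy_balance_cutoff hT hφ1 hφc le_rfl ht.1 ht.2
  -- (a) transport
  have hIa : 2⁻¹ * (∫ τ in Ioo 0 t, ∫ x,
      fderiv ℝ (fun x : EuclideanSpace ℝ (Fin 3) => taoCutoff R r x ^ 8) x (u τ x) * ‖u τ x‖ ^ 2) ≤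
      ν / 8 * (∫ τ in Ioo 0 t, localisedDissipation
        (fun x : EuclideanSpace ℝ (Fin 3) => taoCutoff R r x ^ 8) (u τ)) +
        (2 * C₁ ^ 2 * (ν * A ^ 2 / r ^ 2) +
          1048576 * C₁ ^ 4 * gnsConst3 ^ 6 * (A ^ 6 / (ν ^ 3 * r ^ 4))) * t :=
    mul_integral_Ioo_le_of_slice_le ht.1 hXi hX0 (by positivity) (by positivity) fun τ hτ =>
      half_transport_le (hv1 τ (hI hτ)) (hint τ (hI hτ)) (hA2 τ (hI hτ)) hA0 hr hR hCθ hC₁0 hν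
  -- (b) viscous cross term
  have hIb : -ν * (∫ τ in Ioo 0 t, ∫ x, ∑ i,
      fderiv ℝ (fun x : EuclideanSpace ℝ (Fin 3) => taoCutoff R r x ^ 8) x
        (stdOrthonormalBasis ℝ (EuclideanSpace ℝ (Fin 3)) i) *
        ⟪fderiv ℝ (u τ) x (stdOrthonormalBasis ℝ (EuclideanSpace ℝ (Fin 3)) i), u τ x⟫) ≤
      ν / 8 * (∫ τ in Ioo 0 t, localisedDissipation
        (fun x : EuclideanSpace ℝ (Fin 3) => taoCutoff R r x ^ 8) (u τ)) +
        (384 * C₁ ^ 2 * (ν * A ^ 2 / r ^ 2)) * t :=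
    mul_integral_Ioo_le_of_slice_le ht.1 hXi hX0 (by positivity) (by positivity) fun τ hτ =>
      neg_viscous_cross_le (hv1 τ (hI hτ)) (hint τ (hI hτ)) (hA2 τ (hI hτ)) hr hR hCθ hC₁0 hν
  -- (c) pressure: `p = p̃[u] + Δ⁻¹∇·f + C(τ)` for a.e. `τ`; `p̃` by `X₅`, `Δ⁻¹∇·f` by §2
  have hIc : (∫ τ in Ioo 0 t, ∫ x, p τ x *
      fderiv ℝ (fun x : EuclideanSpace ℝ (Fin 3) => taoCutoff R r x ^ 8) x (u τ x)) ≤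
      ν / 4 * (∫ τ in Ioo 0 t, localisedDissipation
        (fun x : EuclideanSpace ℝ (Fin 3) => taoCutoff R r x ^ 8) (u τ)) +
        (C₅ / 4 * (ν * A ^ 2 / r ^ 2) + 64 * C₅ * (A ^ 6 / (ν ^ 3 * r ^ 4))) * t +
        (ENNReal.ofReal (KΦ * A) * Ψ).toReal := by
    refine integral_Ioo_le_of_slice_le_ae_add (g := fun τ => (ENNReal.ofReal (KΦ * A) * G τ).toReal)
      ht.1 hXi hX0 (by positivity) (by positivity) ?_
      (ENNReal.mul_ne_top ENNReal.ofReal_ne_top hΨt) ?_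
    · -- the lower time integral of the extra error
      calc ∫⁻ τ in Ioo 0 t, ENNReal.ofReal ((ENNReal.ofReal (KΦ * A) * G τ).toReal)
          ≤ ∫⁻ τ in Ioo 0 t, ENNReal.ofReal (KΦ * A) * G τ :=
            lintegral_mono fun τ => ENNReal.ofReal_toReal_le
        _ = ENNReal.ofReal (KΦ * A) * ∫⁻ τ in Ioo 0 t, G τ :=
            lintegral_const_mul' _ _ ENNReal.ofReal_ne_top
        _ ≤ ENNReal.ofReal (KΦ * A) * Ψ :=
            mul_le_mul' le_rfl ((lintegral_mono_set (Ioo_subset_Ioo_right ht.2)).trans hΨ)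
    -- the slice bound, a.e.
    have hsub : Ioo 0 t ⊆ Icc 0 T := Ioo_subset_Icc_self.trans (Icc_subset_Icc_right ht.2)
    filter_upwards [ae_restrict_of_ae_restrict_of_subset hsub hae,
      ae_restrict_of_ae_restrict_of_subset hsub hfin,
      ae_restrict_of_ae_restrict_of_subset hsub hGfin, ae_restrict_mem measurableSet_Ioo]
      with τ hτp hτf hτG hτ
    have hτI := hI hτ
    have hv := h.contDiff_velocity hτI
    have hfτ : ContDiff ℝ 2 (f τ) := contDiff_infty.1 (hf.contDiff_slice hτI) 2
    have hfM : MemLp (f τ) 2 volume := memLp_two_of_lintegral_lt_top (hslab τ hτI) hτf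
    -- the force-potential pairing is integrable (continuous potential, compactly supported weight)
    have hΦc : Continuous (forcePotential (f τ)) := (contDiff_forcePotential hfτ hfM).continuous
    have hD : Continuous fun x =>
        fderiv ℝ (fun y : EuclideanSpace ℝ (Fin 3) => taoCutoff R r y ^ 8) x (u τ x) :=
      (hφ1.continuous_fderiv one_ne_zero).clm_apply hv.continuous
    have hπi : Integrable fun x => forcePotential (f τ) x *
        fderiv ℝ (fun y : EuclideanSpace ℝ (Fin 3) => taoCutoff R r y ^ 8) x (u τ x) :=
      (hΦc.mul hD).integrable_of_hasCompactSupport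
        ((hasCompactSupport_fderiv_apply hφc (u τ)).mul_left)
    have heq := integral_forcedPressure_shift_eq (hv1 τ hτI) (h.divFree τ hτI) hφ1 hφc
      (h.contDiff_pressure hτI).continuous hπi hτp
    -- `p̃` by `X₅` at `ε = ν/4`
    have h5 := hC₅ (u τ) hv A hA0 (hEA τ hτI) R r hr hrR (ν / 4) (by positivity)
    have e1 : C₅ * (ν / 4 * A ^ 2 / r ^ 2 + A ^ 6 / ((ν / 4) ^ 3 * r ^ 4)) =
        C₅ / 4 * (ν * A ^ 2 / r ^ 2) + 64 * C₅ * (A ^ 6 / (ν ^ 3 * r ^ 4)) := by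
      field_simp
      ring
    rw [e1] at h5
    have h5' := (le_abs_self _).trans h5
    -- `Δ⁻¹∇·f` by §2
    have hΦe := enorm_integral_forcePotential_mul_fderiv_cutoff_le (hslab τ hτI) hv.continuous
      hA0 (hEA τ hτI) hR hr hCθ hC₁0
    rw [hKΦe] at hΦe
    have hGfin' : ENNReal.ofReal (KΦ * A) * G τ ≠ ⊤ :=
      ENNReal.mul_ne_top ENNReal.ofReal_ne_top hτG.ne
    have hΦr : |∫ x, forcePotential (f τ) x *
        fderiv ℝ (fun y : EuclideanSpace ℝ (Fin 3) => taoCutoff R r y ^ 8) x (u τ x)| ≤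
        (ENNReal.ofReal (KΦ * A) * G τ).toReal := by
      have h1 : |∫ x, forcePotential (f τ) x *
          fderiv ℝ (fun y : EuclideanSpace ℝ (Fin 3) => taoCutoff R r y ^ 8) x (u τ x)| =
          (‖∫ x, forcePotential (f τ) x *
            fderiv ℝ (fun y : EuclideanSpace ℝ (Fin 3) => taoCutoff R r y ^ 8) x (u τ x)‖ₑ).toReal := by
        rw [Real.enorm_eq_ofReal_abs, ENNReal.toReal_ofReal (abs_nonneg _)]
      rw [h1]
      exact ENNReal.toReal_mono hGfin' hΦe
    have hΦr' := (le_abs_self _).trans hΦr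
    rw [heq]
    linarith
  -- (f) the work of the force against the bound `M`
  have hIf : (∫ τ in Ioo 0 t, ∫ x, taoCutoff R r x ^ 8 * ⟪f τ x, u τ x⟫) ≤
      Real.sqrt (2 * M) * Λ.toReal :=
    (le_abs_self _).trans (h.abs_integral_cutoff_work_le hT hR.le hr.le ht hM hΛ hΛt)
  -- bookkeeping
  have hconv : (ENNReal.ofReal (KΦ * A) * Ψ).toReal = KΦ * A * Ψ.toReal := by
    rw [ENNReal.toReal_mul, ENNReal.toReal_ofReal (by positivity)]
  rw [hconv] at hIc
  have key : 2⁻¹ * (∫ x, taoCutoff R r x ^ 8 * ‖u t x‖ ^ 2) +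
      ν / 2 * (∫ τ in Ioo 0 t, localisedDissipation
        (fun x : EuclideanSpace ℝ (Fin 3) => taoCutoff R r x ^ 8) (u τ)) ≤
      2⁻¹ * (∫ x, taoCutoff R r x ^ 8 * ‖u 0 x‖ ^ 2) +
        ((2 * C₁ ^ 2 * (ν * A ^ 2 / r ^ 2) +
            1048576 * C₁ ^ 4 * gnsConst3 ^ 6 * (A ^ 6 / (ν ^ 3 * r ^ 4))) +
          384 * C₁ ^ 2 * (ν * A ^ 2 / r ^ 2) +
          (C₅ / 4 * (ν * A ^ 2 / r ^ 2) + 64 * C₅ * (A ^ 6 / (ν ^ 3 * r ^ 4)))) * t +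
        KΦ * A * Ψ.toReal + Real.sqrt (2 * M) * Λ.toReal :=
    energy_assembly_arith_forced_integrable hid hIa hIb hIc hIf
  have herr_eq : ((2 * C₁ ^ 2 * (ν * A ^ 2 / r ^ 2) +
          1048576 * C₁ ^ 4 * gnsConst3 ^ 6 * (A ^ 6 / (ν ^ 3 * r ^ 4))) +
        384 * C₁ ^ 2 * (ν * A ^ 2 / r ^ 2) +
        (C₅ / 4 * (ν * A ^ 2 / r ^ 2) + 64 * C₅ * (A ^ 6 / (ν ^ 3 * r ^ 4)))) * t =
      ((386 * C₁ ^ 2 + C₅ / 4) * (ν * A ^ 2 / r ^ 2) +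
        (1048576 * C₁ ^ 4 * gnsConst3 ^ 6 + 64 * C₅) * (A ^ 6 / (ν ^ 3 * r ^ 4))) * t := by
    ring
  rw [herr_eq] at key
  simpa only [localisedEnergy_def] using key

/-- **Tao 2011, §8, (61)–(65) WITH force, `L¹_t L²_x` data, integrated in time along the cut-offs
`θ_n = θ_{n+1,(n+1)/4}`.** For a classical solution of the forced system on `[0,T] × ℝ³` with
`∫|u(t)|² ≤ A²`, smooth force with `Λ = ∫₀ᵀ‖f(t)‖_{L²} dt < ∞`, there is a real sequence `b_n` with
`b_n → ∫|u₀|² + 2Λ²` and, for every `n` and every `t ∈ [0,T]`,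
`E_{θ_n⁸}(u(t)) + (ν/2)∫₀ᵗ∫θ_n⁸|∇u|² ≤ b_n`. Ingredients: the one-step inequality
`localisedEnergy_step_forced` (the tree's (61)–(64) machinery, the forced Lemma 4.1 (i) a.e.
`tao2011_forced_pressure_normalisation_ae_holds`, the estimate of `X₅`
`tao2011_pressureTerm_estimate_holds`, §2–§4) and the absorption of the running supremum
(`M ≤ B + (2M)^{1/2}Λ ⟹ M ≤ 2B + 2Λ²`, Tao's `∂ₜ(E + E₀)^{1/2}` step).
[cite: Tao2011, §8, proof of Lemma 8.1, (61)–(65)] -/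
theorem IsClassicalNSSolutionOn.localisedEnergy_le_forced_integrable
    (h : IsClassicalNSSolutionOn (Icc 0 T) ν f u p) (hν : 0 < ν) (hT : 0 < T)
    (hf : IsSmoothSpaceTimeOn (Icc 0 T) f)
    (hfE : ∫⁻ t in Icc 0 T, (∫⁻ x, ‖f t x‖ₑ ^ 2) ^ (1 / 2 : ℝ) < ⊤)
    {A : ℝ} (hA0 : 0 ≤ A) (hEA : ∀ t ∈ Icc 0 T, ∫⁻ x, ‖u t x‖ₑ ^ 2 ≤ ENNReal.ofReal (A ^ 2)) :
    ∃ b : ℕ → ℝ,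
      Tendsto b atTop (𝓝 ((∫ x, ‖u 0 x‖ ^ 2) +
        2 * (∫⁻ t in Icc 0 T, (∫⁻ x, ‖f t x‖ₑ ^ 2) ^ (1 / 2 : ℝ)).toReal ^ 2)) ∧
      ∀ (n : ℕ), ∀ t ∈ Icc 0 T,
        localisedEnergy (fun x => taoCutoff ((n : ℝ) + 1) (((n : ℝ) + 1) / 4) x ^ 8) (u t) +
            ν / 2 * ∫ s in Ioo 0 t,
              localisedDissipation (fun x => taoCutoff ((n : ℝ) + 1) (((n : ℝ) + 1) / 4) x ^ 8) (u s) ≤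
          b n := by
  obtain ⟨C₅, hC₅0, hC₅⟩ := tao2011_pressureTerm_estimate_holds
  obtain ⟨C₁, hC₁0, hC₁⟩ := exists_norm_fderiv_taoCutoff_le (E := EuclideanSpace ℝ (Fin 3))
  obtain ⟨CH, hCH, hHLS⟩ := exists_hls_one_two_six
  have hK0 : 0 ≤ gnsConst3 := gnsConst3_nonneg
  have hfc : ContinuousOn (uncurry f) (Icc 0 T ×ˢ univ) := hf.continuousOn
  -- the `L¹_t L²_x` size of the force
  set Λe : ℝ≥0∞ := ∫⁻ t in Icc 0 T, (∫⁻ x, ‖f t x‖ₑ ^ 2) ^ (1 / 2 : ℝ) with hΛe_def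
  have hΛt : Λe ≠ ⊤ := hfE.ne
  set Λ : ℝ := Λe.toReal with hΛ_def
  -- the forced pressure normalisation (Lemma 4.1 (i) WITH force, a.e. form — a theorem of the tree)
  have hE' : ∃ C : ℝ≥0, ∀ τ ∈ Icc 0 T, ∫⁻ x, ‖u τ x‖ₑ ^ 2 ≤ C :=
    ⟨(ENNReal.ofReal (A ^ 2)).toNNReal, fun τ hτ =>
      (hEA τ hτ).trans (ENNReal.coe_toNNReal ENNReal.ofReal_ne_top).ge⟩
  obtain ⟨Cp, -, hae⟩ := tao2011_forced_pressure_normalisation_ae_holds hν hT h hf hfE hE'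
  -- the constant of the force-potential term
  set KΦ : ℝ := 32 * C₁ * (unitSphereArea (EuclideanSpace ℝ (Fin 3)))⁻¹ *
    (volume (closedBall (0 : EuclideanSpace ℝ (Fin 3)) 1) ^ (1 / 3 : ℝ)).toReal with hKΦ_def
  have hω : 0 < unitSphereArea (EuclideanSpace ℝ (Fin 3)) := unitSphereArea_pos
  have hKΦ0 : 0 ≤ KΦ := by
    have := inv_nonneg.2 hω.le
    positivity
  -- the tail functionals of §4 and their time integrals
  set G : ℕ → ℝ → ℝ≥0∞ := fun n τ =>
    (∫⁻ x in {y : EuclideanSpace ℝ (Fin 3) |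
        ((n : ℝ) + 1) * (((n : ℝ) + 1) - ((n : ℝ) + 1) / 4) ≤ ‖y‖ ^ 2},
      rieszPotential volume 1 (fun y => ‖f τ y‖ₑ) x ^ (6 : ℝ)) ^ (1 / 6 : ℝ) with hG_def
  set Ψ : ℕ → ℝ≥0∞ := fun n => ∫⁻ τ in Ioo 0 T, G n τ with hΨ_def
  have hΨlim : Tendsto Ψ atTop (𝓝 0) := tendsto_lintegral_tail_rieszPotential hf hfE
  have hslab : ∀ τ ∈ Icc 0 T, Continuous (f τ) := fun τ hτ => (hf.contDiff_slice hτ).continuous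
  have hGle : ∀ n, ∀ τ ∈ Icc 0 T, G n τ ≤ CH * (∫⁻ x, ‖f τ x‖ₑ ^ 2) ^ (1 / 2 : ℝ) := by
    intro n τ hτ
    have h6 := hHLS _ (hslab τ hτ).measurable.enorm.aemeasurable
    simp only [ENNReal.rpow_two] at h6
    exact (ENNReal.rpow_le_rpow (setLIntegral_le_lintegral _ _) (by norm_num)).trans h6
  have hΨle : ∀ n, Ψ n ≤ CH * Λe := by
    intro n
    calc Ψ n ≤ ∫⁻ τ in Ioo 0 T, CH * (∫⁻ x, ‖f τ x‖ₑ ^ 2) ^ (1 / 2 : ℝ) :=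
          setLIntegral_mono' measurableSet_Ioo fun τ hτ => hGle n τ (Ioo_subset_Icc_self hτ)
      _ = CH * ∫⁻ τ in Ioo 0 T, (∫⁻ x, ‖f τ x‖ₑ ^ 2) ^ (1 / 2 : ℝ) :=
          lintegral_const_mul' _ _ hCH.ne
      _ ≤ CH * Λe := mul_le_mul' le_rfl (lintegral_mono_set Ioo_subset_Icc_self)
  have hΨt : ∀ n, Ψ n ≠ ⊤ := fun n =>
    ((hΨle n).trans_lt (ENNReal.mul_lt_top hCH hΛt.lt_top)).ne
  -- finiteness of the slice energies of `f` and of the tail functionals, a.e. in time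
  have hfin_ae : ∀ᵐ τ ∂((volume : Measure ℝ).restrict (Icc 0 T)),
      (∫⁻ x, ‖f τ x‖ₑ ^ 2) ^ (1 / 2 : ℝ) < ⊤ :=
    ae_lt_top' (aemeasurable_lintegral_force_sq_rpow hfc) hfE.ne
  have hfin : ∀ᵐ τ ∂((volume : Measure ℝ).restrict (Icc 0 T)), ∫⁻ x, ‖f τ x‖ₑ ^ 2 < ⊤ := by
    filter_upwards [hfin_ae] with τ hτ
    exact (ENNReal.rpow_lt_top_iff_of_pos (by norm_num : (0 : ℝ) < 1 / 2)).1 hτ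
  have hGfin : ∀ n, ∀ᵐ τ ∂((volume : Measure ℝ).restrict (Icc 0 T)), G n τ < ⊤ := by
    intro n
    filter_upwards [hfin_ae, ae_restrict_mem measurableSet_Icc] with τ hτ hτI
    exact (hGle n τ hτI).trans_lt (ENNReal.mul_lt_top hCH hτ)
  -- the error constants ((62)–(64), at `r = (n+1)/4`)
  set err : ℕ → ℝ := fun n =>
    (386 * C₁ ^ 2 + C₅ / 4) * (ν * A ^ 2 / (((n : ℝ) + 1) / 4) ^ 2) +
      (1048576 * C₁ ^ 4 * gnsConst3 ^ 6 + 64 * C₅) * (A ^ 6 / (ν ^ 3 * (((n : ℝ) + 1) / 4) ^ 4))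
    with herr_def
  have herr0 : ∀ n, 0 ≤ err n := fun n => by positivity
  have herr : Tendsto err atTop (𝓝 0) := by
    set K : ℝ := (386 * C₁ ^ 2 + C₅ / 4) * (16 * ν * A ^ 2) +
      (1048576 * C₁ ^ 4 * gnsConst3 ^ 6 + 64 * C₅) * (256 * A ^ 6 / ν ^ 3) with hKdef
    have herr_le : ∀ n, err n ≤ K * (1 / ((n : ℝ) + 1)) := by
      intro n
      have hm1 : (1 : ℝ) ≤ (n : ℝ) + 1 := by
        have : (0 : ℝ) ≤ n := Nat.cast_nonneg n
        linarith
      have hm : (0 : ℝ) < (n : ℝ) + 1 := by positivity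
      have e1 : ν * A ^ 2 / (((n : ℝ) + 1) / 4) ^ 2 = 16 * ν * A ^ 2 / ((n : ℝ) + 1) ^ 2 := by
        field_simp
        ring
      have e2 : A ^ 6 / (ν ^ 3 * (((n : ℝ) + 1) / 4) ^ 4) =
          256 * A ^ 6 / ν ^ 3 / ((n : ℝ) + 1) ^ 4 := by
        field_simp
        ring
      have i1 : 16 * ν * A ^ 2 / ((n : ℝ) + 1) ^ 2 ≤ 16 * ν * A ^ 2 / ((n : ℝ) + 1) :=
        div_le_div_of_nonneg_left (by positivity) hm (le_self_pow₀ hm1 two_ne_zero)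
      have i2 : 256 * A ^ 6 / ν ^ 3 / ((n : ℝ) + 1) ^ 4 ≤ 256 * A ^ 6 / ν ^ 3 / ((n : ℝ) + 1) :=
        div_le_div_of_nonneg_left (by positivity) hm (le_self_pow₀ hm1 (by norm_num))
      calc err n = (386 * C₁ ^ 2 + C₅ / 4) * (16 * ν * A ^ 2 / ((n : ℝ) + 1) ^ 2) +
            (1048576 * C₁ ^ 4 * gnsConst3 ^ 6 + 64 * C₅) *
              (256 * A ^ 6 / ν ^ 3 / ((n : ℝ) + 1) ^ 4) := by
            simp only [herr_def, e1, e2]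
        _ ≤ (386 * C₁ ^ 2 + C₅ / 4) * (16 * ν * A ^ 2 / ((n : ℝ) + 1)) +
            (1048576 * C₁ ^ 4 * gnsConst3 ^ 6 + 64 * C₅) *
              (256 * A ^ 6 / ν ^ 3 / ((n : ℝ) + 1)) := by
            gcongr
        _ = K * (1 / ((n : ℝ) + 1)) := by
            simp only [hKdef]
            field_simp
    refine squeeze_zero herr0 herr_le ?_
    simpa using (tendsto_one_div_add_atTop_nhds_zero_nat (𝕜 := ℝ)).const_mul K
  -- the bounding sequence
  set b : ℕ → ℝ := fun n =>
    2 * (2⁻¹ * (∫ x, ‖u 0 x‖ ^ 2) + err n * T + KΦ * A * (Ψ n).toReal) + 2 * Λ ^ 2 with hb_def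
  refine ⟨b, ?_, fun n t₀ ht₀ => ?_⟩
  · -- the limit of `b`
    have hΨr : Tendsto (fun n => (Ψ n).toReal) atTop (𝓝 0) := by
      rw [← ENNReal.toReal_zero]
      exact (ENNReal.tendsto_toReal ENNReal.zero_ne_top).comp hΨlim
    have hlim := ((((herr.mul_const T).add (hΨr.const_mul (KΦ * A))).const_add
      (2⁻¹ * ∫ x, ‖u 0 x‖ ^ 2)).const_mul 2).add_const (2 * Λ ^ 2)
    have e : 2 * (2⁻¹ * (∫ x, ‖u 0 x‖ ^ 2) + (0 * T + KΦ * A * 0)) + 2 * Λ ^ 2 =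
        (∫ x, ‖u 0 x‖ ^ 2) + 2 * Λ ^ 2 := by ring
    rw [e] at hlim
    refine hlim.congr fun n => ?_
    simp only [hb_def]
    ring
  -- ### the inequality for fixed `n` and `t₀`: cut-off parameters
  set R : ℝ := (n : ℝ) + 1 with hRdef
  set r : ℝ := ((n : ℝ) + 1) / 4 with hrdef
  have hR : 0 < R := by positivity
  have hr : 0 < r := by positivity
  have hRr4 : R = 4 * r := by rw [hrdef, hRdef]; ring
  have hCθ : ∀ x : EuclideanSpace ℝ (Fin 3), ‖fderiv ℝ (taoCutoff R r) x‖ ≤ C₁ / r := hC₁ R r hr hR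
  have hint : ∀ τ ∈ Icc 0 T, Integrable fun x => ‖u τ x‖ ^ 2 := fun τ hτ =>
    integrable_sq_of_lintegral_enorm_sq_lt_top (h.contDiff_velocity hτ).continuous
      ((hEA τ hτ).trans_lt ENNReal.ofReal_lt_top)
  have hA2 : ∀ τ ∈ Icc 0 T, ∫ x, ‖u τ x‖ ^ 2 ≤ A ^ 2 := by
    intro τ hτ
    have h' := hEA τ hτ
    rw [← ofReal_integral_norm_sq_eq_lintegral (hint τ hτ)] at h'
    exact (ENNReal.ofReal_le_ofReal_iff (by positivity)).1 h'
  -- the one-step inequality with these parameters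
  have step : ∀ t ∈ Icc 0 T, ∀ M : ℝ,
      (∀ τ ∈ Ioo 0 t, localisedEnergy (fun x => taoCutoff R r x ^ 8) (u τ) ≤ M) →
      localisedEnergy (fun x => taoCutoff R r x ^ 8) (u t) +
          ν / 2 * (∫ τ in Ioo 0 t, localisedDissipation
            (fun x : EuclideanSpace ℝ (Fin 3) => taoCutoff R r x ^ 8) (u τ)) ≤
        localisedEnergy (fun x => taoCutoff R r x ^ 8) (u 0) + err n * t +
          KΦ * A * (Ψ n).toReal + Real.sqrt (2 * M) * Λ :=
    fun t ht M hM => h.localisedEnergy_step_forced hν hT hf hA0 hEA hC₅0 hC₅ hr hRr4 hCθ hC₁0.le hae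
      (hΨt n) le_rfl hfin (hGfin n) le_rfl hΛt ht hM
  -- ### the running supremum of the localised energy on `[0, t₀]`
  set Eφ : ℝ → ℝ := fun τ => localisedEnergy (fun x => taoCutoff R r x ^ 8) (u τ) with hEφ_def
  have hEφ0 : ∀ τ, 0 ≤ Eφ τ := fun τ =>
    localisedEnergy_nonneg (fun x => taoCutoff_pow_nonneg R r x 8) _
  have hEφA : ∀ τ ∈ Icc 0 T, Eφ τ ≤ A ^ 2 / 2 := by
    intro τ hτ
    have h1 := localisedEnergy_le_of_le_one (fun x => taoCutoff_pow_nonneg R r x 8)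
      (fun x => taoCutoff_pow_le_one R r x 8) (hint τ hτ)
    have h2 := hA2 τ hτ
    simp only [hEφ_def]
    linarith
  set S : Set ℝ := Eφ '' Icc 0 t₀ with hS_def
  have h0t₀ : (0 : ℝ) ∈ Icc 0 t₀ := ⟨le_rfl, ht₀.1⟩
  have hSne : S.Nonempty := ⟨Eφ 0, 0, h0t₀, rfl⟩
  have hSbdd : BddAbove S := by
    refine ⟨A ^ 2 / 2, ?_⟩
    rintro _ ⟨τ, hτ, rfl⟩
    exact hEφA τ ⟨hτ.1, hτ.2.trans ht₀.2⟩
  set M : ℝ := sSup S with hM_def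
  have hM_ge : ∀ τ ∈ Icc 0 t₀, Eφ τ ≤ M := fun τ hτ => le_csSup hSbdd ⟨τ, hτ, rfl⟩
  have hM0 : 0 ≤ M := (hEφ0 0).trans (hM_ge 0 h0t₀)
  have hD0 : ∀ t, 0 ≤ ∫ τ in Ioo 0 t, localisedDissipation
      (fun x : EuclideanSpace ℝ (Fin 3) => taoCutoff R r x ^ 8) (u τ) := fun t =>
    setIntegral_nonneg measurableSet_Ioo fun τ _ =>
      localisedDissipation_nonneg (fun x => taoCutoff_pow_nonneg R r x 8) _
  -- the `t`-independent part of the bound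
  set B : ℝ := Eφ 0 + err n * t₀ + KΦ * A * (Ψ n).toReal with hB_def
  have hM_le : M ≤ B + Real.sqrt (2 * M) * Λ := by
    refine csSup_le hSne ?_
    rintro _ ⟨t, ht, rfl⟩
    have htT : t ∈ Icc 0 T := ⟨ht.1, ht.2.trans ht₀.2⟩
    have hst := step t htT M (fun τ hτ => hM_ge τ ⟨hτ.1.le, hτ.2.le.trans ht.2⟩)
    have h1 : err n * t ≤ err n * t₀ := mul_le_mul_of_nonneg_left ht.2 (herr0 n)
    have h2 := hD0 t
    have h3 : 0 ≤ ν / 2 * ∫ τ in Ioo 0 t, localisedDissipation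
        (fun x : EuclideanSpace ℝ (Fin 3) => taoCutoff R r x ^ 8) (u τ) :=
      mul_nonneg (by positivity) h2
    simp only [hB_def, hEφ_def] at hst ⊢
    linarith
  have hM2 : M ≤ 2 * B + 2 * Λ ^ 2 := le_of_le_add_sqrt_two_mul hM0 hM_le
  -- ### conclusion at `t₀`
  have hfinal := step t₀ ht₀ M (fun τ hτ => hM_ge τ ⟨hτ.1.le, hτ.2.le⟩)
  have hAMGM := add_sqrt_two_mul_le (B := B) (Λ := Λ) hM0 hM2
  have hE00 : Eφ 0 ≤ 2⁻¹ * ∫ x, ‖u 0 x‖ ^ 2 :=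
    localisedEnergy_le_of_le_one (fun x => taoCutoff_pow_nonneg R r x 8)
      (fun x => taoCutoff_pow_le_one R r x 8) (hint 0 ⟨le_rfl, hT.le⟩)
  have hBle : B ≤ 2⁻¹ * (∫ x, ‖u 0 x‖ ^ 2) + err n * T + KΦ * A * (Ψ n).toReal := by
    have h1 : err n * t₀ ≤ err n * T := mul_le_mul_of_nonneg_left ht₀.2 (herr0 n)
    simp only [hB_def]
    linarith
  have hfinal' : Eφ t₀ + ν / 2 * (∫ τ in Ioo 0 t₀, localisedDissipation
      (fun x : EuclideanSpace ℝ (Fin 3) => taoCutoff R r x ^ 8) (u τ)) ≤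
      B + Real.sqrt (2 * M) * Λ := by
    simp only [hB_def, hEφ_def] at hfinal ⊢
    linarith
  calc localisedEnergy (fun x => taoCutoff R r x ^ 8) (u t₀) +
        ν / 2 * ∫ s in Ioo 0 t₀, localisedDissipation (fun x => taoCutoff R r x ^ 8) (u s)
      ≤ B + Real.sqrt (2 * M) * Λ := hfinal'
    _ ≤ 2 * B + 2 * Λ ^ 2 := hAMGM
    _ ≤ b n := by simp only [hb_def]; linarith

end Localised

/-! ## 6. Assembly: Lemma 8.1 WITH force (the limit `R → ∞`) -/

section Assembly

/-- The real bound `2(∫|u₀|² + 2Λ²) = 2∫|u₀|² + 4Λ²` is dominated by `4(‖u₀‖_{L²} + Λ)²` in `ℝ≥0∞`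
(`a = (∫|u₀|²)^{1/2}`, `Λ` finite). [folklore] -/
private theorem ofReal_two_mul_bound_le {v : EuclideanSpace ℝ (Fin 3) → EuclideanSpace ℝ (Fin 3)}
    (hv : Integrable fun x => ‖v x‖ ^ 2) {Λe : ℝ≥0∞} (hΛt : Λe ≠ ⊤) :
    ENNReal.ofReal (2 * ((∫ x, ‖v x‖ ^ 2) + 2 * Λe.toReal ^ 2)) ≤
      4 * ((∫⁻ x, ‖v x‖ₑ ^ 2) ^ (1 / 2 : ℝ) + Λe) ^ 2 := by
  set a : ℝ≥0∞ := (∫⁻ x, ‖v x‖ₑ ^ 2) ^ (1 / 2 : ℝ) with ha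
  have ha2 : a ^ 2 = ∫⁻ x, ‖v x‖ₑ ^ 2 := by
    rw [ha, ← ENNReal.rpow_natCast, ← ENNReal.rpow_mul]
    norm_num
  have hI0 : 0 ≤ ∫ x, ‖v x‖ ^ 2 := integral_nonneg fun x => sq_nonneg _
  have e : ENNReal.ofReal (2 * ((∫ x, ‖v x‖ ^ 2) + 2 * Λe.toReal ^ 2)) = 2 * a ^ 2 + 4 * Λe ^ 2 := by
    rw [show 2 * ((∫ x, ‖v x‖ ^ 2) + 2 * Λe.toReal ^ 2) =
        2 * (∫ x, ‖v x‖ ^ 2) + 4 * Λe.toReal ^ 2 by ring,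
      ENNReal.ofReal_add (by positivity) (by positivity), ENNReal.ofReal_mul zero_le_two,
      ENNReal.ofReal_mul (by norm_num : (0 : ℝ) ≤ 4), ENNReal.ofReal_pow ENNReal.toReal_nonneg,
      ENNReal.ofReal_toReal hΛt, ofReal_integral_norm_sq_eq_lintegral hv, ha2]
    norm_num
  rw [e]
  calc 2 * a ^ 2 + 4 * Λe ^ 2 ≤ 2 * a ^ 2 + 4 * Λe ^ 2 + (2 * a ^ 2 + 8 * a * Λe) := le_self_add
    _ = 4 * (a + Λe) ^ 2 := by ring

/-- **Tao 2011, Lemma 8.1 (arXiv Lemma 44) WITH force — THE DISCHARGE of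
`tao2011_forced_finiteEnergy_energyBound`** (absolute constant `C = 4`): for a classical solution of
the forced Navier–Stokes system on `[0,T] × ℝ³` with smooth force of finite `L¹_t L²_x` norm and
`sup_t ∫|u(t)|² < ∞`,
`sup_{t ∈ [0,T]} ∫|u(t)|² ≤ 4 (‖u₀‖_{L²} + ‖f‖_{L¹_tL²_x})²` and
`ν ∫₀ᵀ∫|∇u|² ≤ 4 (‖u₀‖_{L²} + ‖f‖_{L¹_tL²_x})²`. Proof: `localisedEnergy_le_forced_integrable`
along `θ_n = θ_{n+1,(n+1)/4}` and the limit `n → ∞` (dominated convergence for the energy slices,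
`tendsto_localisedEnergy_quarter`; monotone convergence for the dissipation), exactly as in the
tree's unforced assembly `tao_finite_energy_smooth_energy_bound_of_localisedEnergyInequality`.
[cite: Tao2011, Lemma 8.1 (arXiv Lemma 44) p. 24, with (6)–(8) p. 3] -/
theorem tao2011_forced_finiteEnergy_energyBound_holds : tao2011_forced_finiteEnergy_energyBound := by
  refine ⟨4, by norm_num, ?_⟩
  intro ν T hν hT f u p hsol hf hfE hE
  obtain ⟨A', hEA⟩ := hE
  -- a real energy bound `A`
  set A : ℝ := Real.sqrt (A' : ℝ) with hAdef
  have hA0 : 0 ≤ A := Real.sqrt_nonneg _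
  have hA2 : ENNReal.ofReal (A ^ 2) = (A' : ℝ≥0∞) := by
    rw [hAdef, Real.sq_sqrt A'.coe_nonneg, ENNReal.ofReal_coe_nnreal]
  have hEA' : ∀ t ∈ Icc 0 T, ∫⁻ x, ‖u t x‖ₑ ^ 2 ≤ ENNReal.ofReal (A ^ 2) := fun t ht =>
    hA2 ▸ hEA t ht
  obtain ⟨b, hb, key⟩ := hsol.localisedEnergy_le_forced_integrable hν hT hf hfE hA0 hEA'
  -- abbreviations
  set Λe : ℝ≥0∞ := ∫⁻ t in Icc 0 T, (∫⁻ x, ‖f t x‖ₑ ^ 2) ^ (1 / 2 : ℝ) with hΛe_def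
  have hΛt : Λe ≠ ⊤ := hfE.ne
  set Binf : ℝ := (∫ x, ‖u 0 x‖ ^ 2) + 2 * Λe.toReal ^ 2 with hBinf
  -- slices
  have hcont : ∀ t ∈ Icc 0 T, Continuous (u t) := fun t ht =>
    (hsol.contDiff_velocity ht).continuous
  have hC1 : ∀ t ∈ Icc 0 T, ContDiff ℝ 1 (u t) := fun t ht =>
    (hsol.contDiff_velocity ht).of_le (by exact_mod_cast le_top)
  have hint : ∀ t ∈ Icc 0 T, Integrable fun x => ‖u t x‖ ^ 2 := fun t ht =>
    integrable_sq_of_lintegral_enorm_sq_lt_top (hcont t ht)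
      ((hEA' t ht).trans_lt ENNReal.ofReal_lt_top)
  have h0T : (0 : ℝ) ∈ Icc 0 T := ⟨le_rfl, hT.le⟩
  have hTT : T ∈ Icc 0 T := ⟨hT.le, le_rfl⟩
  have hBound : ENNReal.ofReal (2 * Binf) ≤
      4 * ((∫⁻ x, ‖u 0 x‖ₑ ^ 2) ^ (1 / 2 : ℝ) + Λe) ^ 2 :=
    ofReal_two_mul_bound_le (hint 0 h0T) hΛt
  -- the cutoff sequence
  have hpos : ∀ n : ℕ, (0 : ℝ) < (n : ℝ) + 1 := fun n => by positivity
  set φ : ℕ → EuclideanSpace ℝ (Fin 3) → ℝ := fun n x =>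
    taoCutoff ((n : ℝ) + 1) (((n : ℝ) + 1) / 4) x ^ 8 with hφdef
  have hφ0 : ∀ n x, 0 ≤ φ n x := fun n x => taoCutoff_pow_nonneg _ _ _ _
  have hφ1 : ∀ n x, φ n x ≤ 1 := fun n x => taoCutoff_pow_le_one _ _ _ _
  have hφc : ∀ n, Continuous (φ n) := fun n => (continuous_taoCutoff _ _).pow 8
  have hφK : ∀ n, support (φ n) ⊆ closedBall (0 : EuclideanSpace ℝ (Fin 3)) ((n : ℝ) + 1) := fun n =>
    support_taoCutoff_pow_subset (hpos n).le (by positivity) (by norm_num)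
  have hφcs : ∀ n, HasCompactSupport (φ n) := fun n =>
    hasCompactSupport_taoCutoff_pow (hpos n).le (by positivity) (by norm_num)
  have hφmono : ∀ x, Monotone fun n => φ n x := by
    intro x m n hmn
    simp only [hφdef]
    apply pow_le_pow_left₀ (taoCutoff_nonneg _ _ _)
    exact taoCutoff_quarter_mono x (hpos m) (by exact_mod_cast Nat.add_le_add_right hmn 1)
  have hφev : ∀ x, ∀ᶠ n : ℕ in atTop, φ n x = 1 := by
    intro x
    have hev : ∀ᶠ n : ℕ in atTop, 2 * ‖x‖ ≤ (n : ℝ) :=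
      tendsto_natCast_atTop_atTop.eventually_ge_atTop (2 * ‖x‖)
    filter_upwards [hev] with n hn
    simp only [hφdef]
    rw [taoCutoff_quarter_eq_one x (hpos n) (by linarith), one_pow]
  -- nonnegativity of the two terms on the left
  have hLE0 : ∀ n t, 0 ≤ localisedEnergy (φ n) (u t) := fun n t =>
    localisedEnergy_nonneg (hφ0 n) _
  have hLD0 : ∀ n t, 0 ≤ ∫ s in Ioo 0 t, localisedDissipation (φ n) (u s) := fun n t =>
    setIntegral_nonneg measurableSet_Ioo fun s _ => localisedDissipation_nonneg (hφ0 n) _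
  refine ⟨fun t ht => ?_, ?_⟩
  · -- (i) the energy bound at time `t`
    have hlim := tendsto_localisedEnergy_quarter (hcont t ht) (hint t ht)
    have hle : 2⁻¹ * ∫ x, ‖u t x‖ ^ 2 ≤ Binf :=
      le_of_tendsto_of_tendsto' hlim hb fun n =>
        (le_add_of_nonneg_right (mul_nonneg (by positivity) (hLD0 n t))).trans (key n t ht)
    have hle' : ∫ x, ‖u t x‖ ^ 2 ≤ 2 * Binf := by linarith
    calc ∫⁻ x, ‖u t x‖ₑ ^ 2 = ENNReal.ofReal (∫ x, ‖u t x‖ ^ 2) :=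
          (ofReal_integral_norm_sq_eq_lintegral (hint t ht)).symm
      _ ≤ ENNReal.ofReal (2 * Binf) := ENNReal.ofReal_le_ofReal hle'
      _ ≤ 4 * ((∫⁻ x, ‖u 0 x‖ₑ ^ 2) ^ (1 / 2 : ℝ) + Λe) ^ 2 := hBound
  · -- (ii) the dissipation bound
    -- real bound for each `n`
    have hreal : ∀ n, ν * ∫ s in Ioo 0 T, localisedDissipation (φ n) (u s) ≤ 2 * b n := by
      intro n
      have h1 := key n T hTT
      have h2 := hLE0 n T
      nlinarith
    -- continuity and integrability of the localised dissipation in time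
    have hLDc : ∀ n, ContinuousOn (fun t => localisedDissipation (φ n) (u t)) (Icc 0 T) := fun n =>
      continuousOn_localisedDissipation hsol.smooth_velocity hT (hφc n) (isCompact_closedBall 0 _)
        (hφK n)
    have hLDi : ∀ n, IntegrableOn (fun t => localisedDissipation (φ n) (u t)) (Ioo 0 T) := fun n =>
      ((hLDc n).integrableOn_Icc).mono_set Ioo_subset_Icc_self
    -- the inner lintegrals on `(0, T)`
    have hinner : ∀ n, ∀ t ∈ Ioo 0 T,
        ∫⁻ x, ENNReal.ofReal (φ n x * frobeniusNormSq (fderiv ℝ (u t) x)) =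
          ENNReal.ofReal (localisedDissipation (φ n) (u t)) := by
      intro n t ht
      have ht' : t ∈ Icc 0 T := Ioo_subset_Icc_self ht
      have hci : Continuous fun x => φ n x * frobeniusNormSq (fderiv ℝ (u t) x) :=
        (hφc n).mul (continuous_frobeniusNormSq_clm.comp ((hC1 t ht').continuous_fderiv one_ne_zero))
      have hii : Integrable fun x => φ n x * frobeniusNormSq (fderiv ℝ (u t) x) :=
        hci.integrable_of_hasCompactSupport (hφcs n).mul_right
      rw [localisedDissipation, ofReal_integral_eq_lintegral_ofReal hii
        (ae_of_all _ fun x => mul_nonneg (hφ0 n x) (frobeniusNormSq_nonneg _))]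
    -- `a n`: the localised space-time dissipation as a lintegral
    have ha : ∀ n, ∫⁻ t in Ioo 0 T, ∫⁻ x,
        ENNReal.ofReal (φ n x * frobeniusNormSq (fderiv ℝ (u t) x)) =
          ENNReal.ofReal (∫ t in Ioo 0 T, localisedDissipation (φ n) (u t)) := by
      intro n
      rw [ofReal_integral_eq_lintegral_ofReal (hLDi n)
        (ae_of_all _ fun t => localisedDissipation_nonneg (hφ0 n) (u t))]
      refine setLIntegral_congr_fun measurableSet_Ioo ?_
      exact fun t ht => hinner n t ht
    -- measurability in `t` of the inner lintegrals
    have hameas : ∀ n, AEMeasurable (fun t => ∫⁻ x,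
        ENNReal.ofReal (φ n x * frobeniusNormSq (fderiv ℝ (u t) x)))
        (volume.restrict (Ioo 0 T)) := by
      intro n
      have h1 : AEMeasurable (fun t => ENNReal.ofReal (localisedDissipation (φ n) (u t)))
          (volume.restrict (Ioo 0 T)) :=
        ENNReal.measurable_ofReal.comp_aemeasurable
          (((hLDc n).mono Ioo_subset_Icc_self).aemeasurable measurableSet_Ioo)
      refine h1.congr ?_
      filter_upwards [ae_restrict_mem measurableSet_Ioo] with t ht
      exact (hinner n t ht).symm
    -- monotone convergence in `x`, then in `t`
    have hsupx : ∀ t ∈ Ioo 0 T, ∫⁻ x, ENNReal.ofReal (frobeniusNormSq (fderiv ℝ (u t) x)) =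
        ⨆ n, ∫⁻ x, ENNReal.ofReal (φ n x * frobeniusNormSq (fderiv ℝ (u t) x)) := by
      intro t ht
      have ht' : t ∈ Icc 0 T := Ioo_subset_Icc_self ht
      rw [← lintegral_iSup']
      · refine lintegral_congr fun x => ?_
        apply le_antisymm
        · obtain ⟨N, hN⟩ := (hφev x).exists
          refine le_iSup_of_le N ?_
          rw [hN, one_mul]
        · exact iSup_le fun n => ENNReal.ofReal_le_ofReal
            (mul_le_of_le_one_left (frobeniusNormSq_nonneg _) (hφ1 n x))
      · intro n
        exact ((hφc n).mul (continuous_frobeniusNormSq_clm.comp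
          ((hC1 t ht').continuous_fderiv one_ne_zero))).measurable.ennreal_ofReal.aemeasurable
      · exact ae_of_all _ fun x m n hmn => ENNReal.ofReal_le_ofReal
          (mul_le_mul_of_nonneg_right (hφmono x hmn) (frobeniusNormSq_nonneg _))
    have hsup : ∫⁻ t in Ioo 0 T, ∫⁻ x, ENNReal.ofReal (frobeniusNormSq (fderiv ℝ (u t) x)) =
        ⨆ n, ∫⁻ t in Ioo 0 T, ∫⁻ x,
          ENNReal.ofReal (φ n x * frobeniusNormSq (fderiv ℝ (u t) x)) := by
      rw [← lintegral_iSup' hameas]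
      · exact setLIntegral_congr_fun measurableSet_Ioo hsupx
      · exact ae_of_all _ fun t m n hmn => lintegral_mono fun x => ENNReal.ofReal_le_ofReal
          (mul_le_mul_of_nonneg_right (hφmono x hmn) (frobeniusNormSq_nonneg _))
    -- monotonicity of `a n`
    have hamono : Monotone fun n => ∫⁻ t in Ioo 0 T, ∫⁻ x,
        ENNReal.ofReal (φ n x * frobeniusNormSq (fderiv ℝ (u t) x)) :=
      fun m n hmn => lintegral_mono fun t => lintegral_mono fun x => ENNReal.ofReal_le_ofReal
        (mul_le_mul_of_nonneg_right (hφmono x hmn) (frobeniusNormSq_nonneg _))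
    -- limit of the real bounds
    have hb2 : Tendsto (fun n => ENNReal.ofReal (2 * b n)) atTop (𝓝 (ENNReal.ofReal (2 * Binf))) :=
      ENNReal.tendsto_ofReal (hb.const_mul 2)
    -- conclusion
    rw [hsup, ENNReal.mul_iSup]
    refine iSup_le fun n => ?_
    refine le_trans ?_ hBound
    refine ge_of_tendsto hb2 (eventually_atTop.2 ⟨n, fun m hm => ?_⟩)
    calc ENNReal.ofReal ν * ∫⁻ t in Ioo 0 T, ∫⁻ x,
          ENNReal.ofReal (φ n x * frobeniusNormSq (fderiv ℝ (u t) x))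
        ≤ ENNReal.ofReal ν * ∫⁻ t in Ioo 0 T, ∫⁻ x,
          ENNReal.ofReal (φ m x * frobeniusNormSq (fderiv ℝ (u t) x)) :=
          mul_le_mul' le_rfl (hamono hm)
      _ = ENNReal.ofReal (ν * ∫ t in Ioo 0 T, localisedDissipation (φ m) (u t)) := by
          rw [ha m, ENNReal.ofReal_mul hν.le]
      _ ≤ ENNReal.ofReal (2 * b m) := ENNReal.ofReal_le_ofReal (hreal m)

end Assembly

end Literature.Analysis.FluidPDE

end
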